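import Literature.MathematicalPhysics.QuantumLattice.TorusSectorGibbsFillingBoxAllTori
import Literature.MathematicalPhysics.QuantumLattice.GibbsLogPartitionTemperatureCouplingConvexity
import Literature.MathematicalPhysics.QuantumLattice.HubbardOpenBoxWitnessPlanes
import Literature.MathematicalPhysics.QuantumLattice.HubbardTTPrimeFreeKineticBound
import Literature.MathematicalPhysics.QuantumLattice.HubbardAtomicLimit
import HarnessLib

/-!
# Transport of the free-energy-route INPUTS across couplings: the open-box canonical partition
# function of the `t–t'` Hubbard model is antitone in `U`, has Peierls–Bogoliubov tangent floors in
# `(t, t', U)` and in `(β, t, t', U)`, and ONE certified box number words a whole `U`-box at `T > 0`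

Family `hubbard` (topic `MathematicalPhysics/QuantumLattice`). Written for stage S2 of the Hubbard
material-oracle programme («robustness lemmas consumed by S2: monotonicity/Lipschitz of certified words in
(t′, U, μ) so a parameter BOX maps to a certified word»; `U`-direction, `T > 0` leg, FREE-ENERGY ROUTE).
The free-energy-route producers of the torus-limit thermal convention
(`TorusSectorGibbsOpenBoxBound`, `TorusSectorGibbsFillingBoxFreeEnergy`, `TorusSectorGibbsFillingBoxAllTori`)
turn ONE certified number
`0 < z ≤ Re Z_β(H^open_{a×b}(t,t',U); p, q)`, `Z_β(A; p, q) = Z_β(spinSectorHamiltonian p q A)` the canonical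
partition function of the OPEN `a × b` cluster in the spin sector `(N↑, N↓) = (p, q)`, into a thermal energy cap
for EVERY torus-limit thermal state at the SAME coupling `(t, t', U)` and inverse temperature `β`
(e.g. `e_Φ(ω) ≤ (1.371 − log z/16)/β` at `n = 7/8` from the `4 × 4` box,
`IsTorusLimitOfMixture.meanEnergy_hubbardTTPrime_le_of_openBox_seven_eighths_allTori`). This file moves that
INPUT across couplings, so that one box computation serves a whole parameter box:

* §1 The sector compression is linear; `H^open(t,t',U)|_{(p,q)} = t·K₁| + t'·K₂| + U·D|`
  (`spinSectorHamiltonian_hubbardOpenBoxTT'_eq_smul_add`, `…_sub`, `…_eq_add_smul_U`); the interaction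
  direction `D = H^open(0,0,1) = Σ_x n_{x↑}n_{x↓}` is diagonal with eigenvalue the number of doubly occupied
  sites, hence `0 ≤ D|_{(p,q)} ≤ min p q` (`posSemidef_spinSectorHamiltonian_docc`,
  `posSemidef_min_smul_one_sub_spinSectorHamiltonian_docc`) and every thermal docc mean of the box lies in
  `[0, min p q]` (`re_gibbsState_docc_openBox_nonneg / _le_min`).
* §2 THE `U`-DIRECTION. `log Re Z_β(H^open(t,s,U); p,q)` is ANTITONE in `U` for `β ≥ 0`
  (`log_partitionFn_openBox_anti_U`, `partitionFn_openBox_re_anti_U`): a certified floor `z` at `U_A` is a floor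
  at every `U ≤ U_A` for free (`openBox_partitionFn_floor_of_le_U`). The Peierls–Bogoliubov bracket
  `β(U₂−U₁)⟨D|⟩_{U₂} ≤ log Z(U₁) − log Z(U₂) ≤ β(U₂−U₁)⟨D|⟩_{U₁}` (`log_partitionFn_openBox_sub_mem_Icc_U`), the
  thermal docc of the box antitone in `U` (`re_gibbsState_docc_openBox_anti_U`), and the TANGENT floor
  `log Z(U_A) − β(U−U_A)⟨D|⟩_{U_A} ≤ log Z(U)` for EVERY `U` (`log_partitionFn_openBox_ge_tangent_U`; the
  Hellmann–Feynman slope is the anchor's thermal double occupancy), priced by a certified slope window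
  (`…_ge_of_docc_mem_Icc_U`) or kinematically by `[0, min p q]` (`…_ge_kinematic_U`); the `z`-forms a producer
  consumes: `z·exp(−β·max((U−U_A)dlo, (U−U_A)dhi)) ≤ Re Z(U)` (`openBox_partitionFn_floor_transport_U`,
  `…_kinematic`).
* §3 JOINT TANGENT PLANES: in `(t, s, U)` at fixed `β` (`log_partitionFn_openBox_ge_tangent`, sign-split reading
  with slope windows `log_partitionFn_openBox_ge_of_slopes_mem_Icc`, `z`-form `openBox_partitionFn_floor_transport`),
  convexity of `(t,s,U) ↦ log Re Z_β` (`convexOn_log_partitionFn_openBox`), and in TEMPERATURE × couplings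
  (`log_partitionFn_openBox_ge_tangent_temperature`: slopes multiply the scaled increments `βt − β₀t₀, …`) —
  the open-box instance of `GibbsFreeEnergyCouplingConcavity` / `GibbsLogPartitionTemperatureCouplingConvexity`
  (the tree had the torus, grand-canonical and canonical sector, only).
* §4 THE TORUS-SIDE HOT INPUTS are antitone in `U` as well: the canonical-sector and the grand-canonical torus
  `log`-partition functions (`log_partitionFn_sectorHamiltonianTT'_anti_U`,
  `log_partitionFn_hubbardTorusTT'_sub_mu_anti_U`), so an eventual hot free-energy bound certified at `U₁`
  holds at every `U ≥ U₁` (`eventually_log_partitionFn_sectorHamiltonianTT'_le_of_le_U`,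
  `eventually_log_partitionFn_grandCanonical_le_of_le_U`).
* §5 BOX ⇒ WORD (composition with the producers): from ONE certified `z` at an anchor `(s_A, U_A)` and the
  anchor's slope windows, the thermal energy cap at EVERY target `(s, U)`
  (`IsTorusLimitOfMixture.meanEnergy_hubbardTTPrime_le_of_openBox_seven_eighths_allTori_of_anchor`, kinematic
  `U`-ray form `…_of_anchor_U_kinematic`: `e_Φ(ω) ≤ (1.371 − (log z − 7β(U−U_A)⁺)/16)/β`, free form for
  `U ≤ U_A` `…_of_le_U`; general commensurate filling `…le_entropy_sub_log_openBox_div_allTori_of_anchor`); and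
  PRODUCER II on a `U`-box with NO loss: box partition functions certified at the RIGHT end `U₂` and the hot
  bound certified at the LEFT end `U₁` word every `U ∈ [U₁, U₂]`
  (`IsTorusLimitOfMixture.meanEnergy_hubbardTTPrime_le_hot_sub_chord_div_of_UBox_allTori`).

Everything is PROVED; no definition, no named fact, no number. HONEST SCOPE: transport lemmas for the INPUTS
of the free-energy route (finite-cluster / finite-torus partition functions, where everything is a trace);
the torus-limit statements of §5 are the producers' theorems fed with transported inputs. No certificate is
evaluated here; no thermodynamic-limit free energy; no phase sentence. WHAT THIS IS NOT: a number, a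
certificate or a phase verdict.

## Mathlib / tree search

REUSED: `log_partitionFn_sub_le_log_partitionFn_add`, `log_partitionFn_le_of_posSemidef`,
`abs_log_partitionFn_sub_log_partitionFn_le`, `partitionFn_re_pos`, `abs_re_gibbsState_le`
(`ApproximatingHamiltonianProofs`), `gibbsState_nonneg_of_posSemidef`, `gibbsState_one`, `partitionFn_pos`
(`FinDimSpectrum`), `isHermitian_real_smul` (`TraceInequalitiesProofs`), `convexOn_log_partitionFn_affine`
(`GibbsFreeEnergyCouplingConcavity`), `log_partitionFn_linear_ge_tangent_temperature`
(`GibbsLogPartitionTemperatureCouplingConvexity`), `hubbardOpenBoxTT'_eq_smul_add` (`HubbardOpenBoxWitnessPlanes`),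
`sum_numberOp_mul_numberOp_eq_diagonal`, `doublyOccupied` (`HubbardAtomicLimit`), `spinSectorHamiltonian`,
`isHermitian_spinSectorHamiltonian`, `partitionFn_spinSector_re_pos`, `nonempty_spinConfig` (`SectorPartitionFnCut`,
`TorusSectorPartitionFnTiling`), `TTPrimeFree.hubbardTorusTT'_eq_add_smul` (`HubbardTTPrimeFreeKineticBound`),
`sectorHamiltonianTT'`, `isHermitian_sectorHamiltonianTT'`, `nonempty_szConfig` (`TorusSectorGibbsEnergyWindow`),
the producers `IsTorusLimitOfMixture.meanEnergy_hubbardTTPrime_le_of_openBox_seven_eighths_allTori`,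
`…le_entropy_sub_log_openBox_div_allTori`, `…le_hot_sub_chord_div_of_fillingBox_allTori`
(`TorusSectorGibbsFillingBoxAllTori`). `lean search 'partitionFn_openBox'` → tiling inequalities and
monotonicity in the box SIZE only (`partitionFn_openBox_mono`); `lean search 'hubbardOpenBoxTT.*gibbsState|anti_U'`
→ the torus sector only (`HubbardTTPrimeDoccTransportThermal.log_partitionFn_sector_sub_mem_Icc_U`, mixture form):
no coupling transport of the open-box partition function existed.

## References

* E. H. Lieb, *The classical limit of quantum spin systems*, Commun. Math. Phys. 31 (1973) 327–340, §V
  eqs. (5.2)–(5.4) (Bogoliubov's inequality `λ⟨A⟩ ≥ f(λ) − f(0)` for `f(λ) = −β⁻¹ log tr e^{−β(H+λA)}`).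
  [cite: Lieb1973, §V (5.2)–(5.4)]
* D. Ruelle, *Statistical Mechanics: Rigorous Results* (1969), §2.5 (Peierls and Bogoliubov convexity
  inequalities for `log tr e^{A}`), §3.3 (3.11)–(3.18) (sub-box estimates). [cite: Ruelle1969, §2.5]
* R. B. Israel, *Convexity in the Theory of Lattice Gases* (1979), Theorem I.3.4 and Lemma II.3.1 (the pressure
  is convex and monotone in the interaction; finite-volume canonical partition functions).
  [cite: Israel1979, Thm. I.3.4]
* T. Koma, H. Tasaki, J. Stat. Phys. 76 (1994) 745, §1 (`∂E/∂U = ⟨D⟩`, the interaction enters linearly).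
  [cite: KomaTasaki1994, §1]
* H. Tasaki, *Physics and Mathematics of Quantum Many-Body Systems* (2020), §9.3 (occupation-number
  description of the Hubbard interaction). [cite: Tasaki2020, §9.3]
-/

noncomputable section

namespace Literature.MathematicalPhysics.QuantumLattice

open Matrix Finset HubbardWave0 ThermodynamicLimit LiebThm1 Literature.Probability.LatticeModels
open _root_.Filter
open scoped _root_.Topology ComplexOrder BigOperators Matrix.Norms.L2Operator

/-! ### §1 Linear structure of the open-box sector Hamiltonian; the interaction direction -/

section Compression

variable {Λ : Type*} [LinearOrder Λ] [Fintype Λ]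

/-- The sector compression is additive: `(A + B)|_{(p,q)} = A|_{(p,q)} + B|_{(p,q)}` (the canonical-sector
compression of Israel's finite-volume formalism is linear in the Hamiltonian). [cite: Israel1979, §I.3 eq. (26)] -/
theorem spinSectorHamiltonian_add (p q : ℕ) (A B : Matrix (Finset (Orb Λ)) (Finset (Orb Λ)) ℂ) :
    spinSectorHamiltonian p q (A + B) = spinSectorHamiltonian p q A + spinSectorHamiltonian p q B := by
  ext i j
  rfl

/-- The sector compression commutes with scalars: `(c • A)|_{(p,q)} = c • A|_{(p,q)}`.
[cite: Israel1979, §I.3 eq. (26)] -/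
theorem spinSectorHamiltonian_smul (p q : ℕ) (c : ℂ) (A : Matrix (Finset (Orb Λ)) (Finset (Orb Λ)) ℂ) :
    spinSectorHamiltonian p q (c • A) = c • spinSectorHamiltonian p q A := by
  ext i j
  rfl

/-- The sector compression is subtractive: `(A − B)|_{(p,q)} = A|_{(p,q)} − B|_{(p,q)}`.
[cite: Israel1979, §I.3 eq. (26)] -/
theorem spinSectorHamiltonian_sub (p q : ℕ) (A B : Matrix (Finset (Orb Λ)) (Finset (Orb Λ)) ℂ) :
    spinSectorHamiltonian p q (A - B) = spinSectorHamiltonian p q A - spinSectorHamiltonian p q B := by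
  ext i j
  rfl

/-- In the spin sector `(p, q)` a configuration has at most `min p q` doubly occupied sites (the doubly
occupied sites are among the up-occupied and among the down-occupied ones; Tasaki's occupation-number
description of the interaction). [cite: Tasaki2020, §9.3] -/
theorem card_doublyOccupied_le_min {p q : ℕ} {s : Finset (Orb Λ)} (hs : spinConfig p q s) :
    (doublyOccupied s).card ≤ min p q := by
  unfold doublyOccupied
  exact le_min (hs.1 ▸ card_le_card inter_subset_left) (hs.2 ▸ card_le_card inter_subset_right)

/-- Natural numbers are nonnegative complex numbers (order of `ℂ` along the reals). [folklore] -/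
private theorem natCast_nonneg_complex (k : ℕ) : (0 : ℂ) ≤ (k : ℂ) := by
  rw [← Complex.ofReal_natCast]
  exact Complex.zero_le_real.2 (Nat.cast_nonneg k)

/-- A nonnegative real multiple of a diagonal matrix with natural-number entries is positive semidefinite.
[folklore] -/
private theorem posSemidef_real_smul_diagonal_natCast {m : Type*} [Fintype m] [DecidableEq m] (k : m → ℕ)
    {c : ℝ} (hc : 0 ≤ c) :
    (((c : ℝ) : ℂ) • diagonal fun i => ((k i : ℕ) : ℂ)).PosSemidef := by
  rw [← diagonal_smul]
  refine posSemidef_diagonal_iff.2 fun i => ?_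
  have h : (0 : ℂ) ≤ ((c * (k i : ℝ) : ℝ) : ℂ) := Complex.zero_le_real.2 (mul_nonneg hc (Nat.cast_nonneg _))
  simpa using h

/-- **A nonnegative multiple of the double occupancy is positive semidefinite**:
`0 ≤ c · Σ_x n_{x↑} n_{x↓}` for `c ≥ 0` (diagonal with natural-number eigenvalues), on any finite site set.
[cite: KomaTasaki1994, §1] -/
theorem posSemidef_real_smul_sum_numberOp_mul_numberOp {c : ℝ} (hc : 0 ≤ c) :
    (((c : ℝ) : ℂ) • ∑ x : Λ, numberOp x 0 * numberOp x 1 :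
      Matrix (Finset (Orb Λ)) (Finset (Orb Λ)) ℂ).PosSemidef := by
  rw [sum_numberOp_mul_numberOp_eq_diagonal]
  exact posSemidef_real_smul_diagonal_natCast _ hc

end Compression

section OpenBox

variable (a b : ℕ)

/-- The unit interaction direction of the open cluster is the total double occupancy:
`H^open_{a×b}(0, 0, 1) = Σ_x n_{x↑} n_{x↓}`. [cite: KomaTasaki1994, §1] -/
theorem hubbardOpenBoxTT'_zero_zero_one :
    hubbardOpenBoxTT' a b 0 0 1 = ∑ x : Fin a ×ₗ Fin b, numberOp x 0 * numberOp x 1 := by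
  simp [hubbardOpenBoxTT', hamiltonian]

/-- `H^open_{a×b}(0, 0, 1)` is diagonal in the occupation basis with eigenvalue the number of doubly
occupied sites. [cite: KomaTasaki1994, §1] -/
theorem hubbardOpenBoxTT'_zero_zero_one_eq_diagonal :
    hubbardOpenBoxTT' a b 0 0 1 =
      diagonal fun s : Finset (Orb (Fin a ×ₗ Fin b)) => ((doublyOccupied s).card : ℂ) := by
  rw [hubbardOpenBoxTT'_zero_zero_one, sum_numberOp_mul_numberOp_eq_diagonal]

/-- **The open-box sector Hamiltonian is linear in its couplings**:
`H^open(t,s,U)|_{(p,q)} = t·H^open(1,0,0)| + s·H^open(0,1,0)| + U·H^open(0,0,1)|` (unit nearest-neighbour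
hopping, unit diagonal hopping, double occupancy). [cite: KomaTasaki1994, §1] -/
theorem spinSectorHamiltonian_hubbardOpenBoxTT'_eq_smul_add (p q : ℕ) (t s U : ℝ) :
    spinSectorHamiltonian p q (hubbardOpenBoxTT' a b t s U) =
      (t : ℂ) • spinSectorHamiltonian p q (hubbardOpenBoxTT' a b 1 0 0) +
        (s : ℂ) • spinSectorHamiltonian p q (hubbardOpenBoxTT' a b 0 1 0) +
          (U : ℂ) • spinSectorHamiltonian p q (hubbardOpenBoxTT' a b 0 0 1) := by
  rw [hubbardOpenBoxTT'_eq_smul_add a b t s U, spinSectorHamiltonian_add, spinSectorHamiltonian_add,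
    spinSectorHamiltonian_smul, spinSectorHamiltonian_smul, spinSectorHamiltonian_smul]

/-- **Coupling increments** of the open-box sector Hamiltonian:
`H^open(t,s,U)| − H^open(t₀,s₀,U₀)| = (t−t₀)·K₁| + (s−s₀)·K₂| + (U−U₀)·D|`. [cite: KomaTasaki1994, §1] -/
theorem spinSectorHamiltonian_hubbardOpenBoxTT'_sub (p q : ℕ) (t s U t₀ s₀ U₀ : ℝ) :
    spinSectorHamiltonian p q (hubbardOpenBoxTT' a b t s U) -
        spinSectorHamiltonian p q (hubbardOpenBoxTT' a b t₀ s₀ U₀) =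
      ((t - t₀ : ℝ) : ℂ) • spinSectorHamiltonian p q (hubbardOpenBoxTT' a b 1 0 0) +
        ((s - s₀ : ℝ) : ℂ) • spinSectorHamiltonian p q (hubbardOpenBoxTT' a b 0 1 0) +
          ((U - U₀ : ℝ) : ℂ) • spinSectorHamiltonian p q (hubbardOpenBoxTT' a b 0 0 1) := by
  rw [spinSectorHamiltonian_hubbardOpenBoxTT'_eq_smul_add a b p q t s U,
    spinSectorHamiltonian_hubbardOpenBoxTT'_eq_smul_add a b p q t₀ s₀ U₀]
  simp only [Complex.ofReal_sub]
  module

/-- **The interaction enters linearly**: `H^open(t,s,U₂)| = H^open(t,s,U₁)| + (U₂ − U₁)·D|`.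
[cite: KomaTasaki1994, §1] -/
theorem spinSectorHamiltonian_hubbardOpenBoxTT'_eq_add_smul_U (p q : ℕ) (t s U₁ U₂ : ℝ) :
    spinSectorHamiltonian p q (hubbardOpenBoxTT' a b t s U₂) =
      spinSectorHamiltonian p q (hubbardOpenBoxTT' a b t s U₁) +
        ((U₂ - U₁ : ℝ) : ℂ) • spinSectorHamiltonian p q (hubbardOpenBoxTT' a b 0 0 1) := by
  rw [spinSectorHamiltonian_hubbardOpenBoxTT'_eq_smul_add a b p q t s U₂,
    spinSectorHamiltonian_hubbardOpenBoxTT'_eq_smul_add a b p q t s U₁]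
  simp only [Complex.ofReal_sub]
  module

/-- The open-box sector Hamiltonian is Hermitian (real couplings). [cite: Israel1979, Thm. I.3.4] -/
theorem isHermitian_spinSectorHamiltonian_hubbardOpenBoxTT' (p q : ℕ) (t s U : ℝ) :
    (spinSectorHamiltonian p q (hubbardOpenBoxTT' a b t s U)).IsHermitian :=
  isHermitian_spinSectorHamiltonian p q (hubbardOpenBoxTT'_isHermitian a b t s U)

/-- The compressed interaction direction is diagonal with eigenvalue the number of doubly occupied sites.
[cite: KomaTasaki1994, §1] -/
theorem spinSectorHamiltonian_docc_eq_diagonal (p q : ℕ) :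
    spinSectorHamiltonian p q (hubbardOpenBoxTT' a b 0 0 1) =
      diagonal fun s : Subtype (spinConfig (Λ := Fin a ×ₗ Fin b) p q) =>
        ((doublyOccupied s.1).card : ℂ) := by
  unfold spinSectorHamiltonian
  rw [hubbardOpenBoxTT'_zero_zero_one_eq_diagonal, submatrix_diagonal _ _ Subtype.val_injective]
  rfl

/-- **`0 ≤ D|_{(p,q)}`**: the compressed double occupancy is positive semidefinite.
[cite: KomaTasaki1994, §1] -/
theorem posSemidef_spinSectorHamiltonian_docc (p q : ℕ) :
    (spinSectorHamiltonian p q (hubbardOpenBoxTT' a b 0 0 1)).PosSemidef := by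
  rw [spinSectorHamiltonian_docc_eq_diagonal]
  exact posSemidef_diagonal_iff.2 fun s => natCast_nonneg_complex _

/-- **`0 ≤ c·D|_{(p,q)}` for `c ≥ 0`** (the increment of the sector Hamiltonian along `U`).
[cite: KomaTasaki1994, §1] -/
theorem posSemidef_real_smul_spinSectorHamiltonian_docc (p q : ℕ) {c : ℝ} (hc : 0 ≤ c) :
    (((c : ℝ) : ℂ) • spinSectorHamiltonian p q (hubbardOpenBoxTT' a b 0 0 1)).PosSemidef := by
  rw [spinSectorHamiltonian_docc_eq_diagonal]
  exact posSemidef_real_smul_diagonal_natCast _ hc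

/-- **`D|_{(p,q)} ≤ min p q`**: `(min p q)·1 − D|_{(p,q)}` is positive semidefinite (at most `min p q`
doubly occupied sites in the sector). [cite: KomaTasaki1994, §1] -/
theorem posSemidef_min_smul_one_sub_spinSectorHamiltonian_docc (p q : ℕ) :
    (((min p q : ℕ) : ℂ) • (1 : Matrix (Subtype (spinConfig (Λ := Fin a ×ₗ Fin b) p q))
        (Subtype (spinConfig (Λ := Fin a ×ₗ Fin b) p q)) ℂ) -
      spinSectorHamiltonian p q (hubbardOpenBoxTT' a b 0 0 1)).PosSemidef := by
  rw [spinSectorHamiltonian_docc_eq_diagonal]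
  have h : ((min p q : ℕ) : ℂ) • (1 : Matrix (Subtype (spinConfig (Λ := Fin a ×ₗ Fin b) p q))
        (Subtype (spinConfig (Λ := Fin a ×ₗ Fin b) p q)) ℂ) -
      (diagonal fun s : Subtype (spinConfig (Λ := Fin a ×ₗ Fin b) p q) =>
        ((doublyOccupied s.1).card : ℂ)) =
      diagonal fun s : Subtype (spinConfig (Λ := Fin a ×ₗ Fin b) p q) =>
        (((min p q : ℕ) : ℂ) - ((doublyOccupied s.1).card : ℂ)) := by
    ext i j
    by_cases hij : i = j
    · subst hij
      simp
    · simp [hij]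
  rw [h]
  refine posSemidef_diagonal_iff.2 fun s => ?_
  have hle : ((doublyOccupied s.1).card : ℝ) ≤ ((min p q : ℕ) : ℝ) :=
    Nat.cast_le.mpr (card_doublyOccupied_le_min s.2)
  have h : (0 : ℂ) ≤ ((((min p q : ℕ) : ℝ) - ((doublyOccupied s.1).card : ℝ) : ℝ) : ℂ) :=
    Complex.zero_le_real.2 (sub_nonneg.2 hle)
  rw [Complex.ofReal_sub, Complex.ofReal_natCast, Complex.ofReal_natCast] at h
  show (0 : ℂ) ≤ ((min p q : ℕ) : ℂ) - ((doublyOccupied s.1).card : ℂ)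
  exact h

/-- **Thermal docc means of the box are nonnegative**: `0 ≤ Re⟨D|_{(p,q)}⟩_{β,H}` for every Hermitian `H`
on the sector (in particular every canonical Gibbs state of the box). [cite: KomaTasaki1994, §1] -/
theorem re_gibbsState_docc_openBox_nonneg (p q : ℕ)
    {H : Matrix (Subtype (spinConfig (Λ := Fin a ×ₗ Fin b) p q))
      (Subtype (spinConfig (Λ := Fin a ×ₗ Fin b) p q)) ℂ} (hH : H.IsHermitian) (β : ℝ) :
    0 ≤ (gibbsState β H (spinSectorHamiltonian p q (hubbardOpenBoxTT' a b 0 0 1))).re :=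
  (Complex.nonneg_iff.mp
    (gibbsState_nonneg_of_posSemidef β hH (posSemidef_spinSectorHamiltonian_docc a b p q))).1

/-- **Thermal docc means of the box are at most `min p q`**: `Re⟨D|_{(p,q)}⟩_{β,H} ≤ min p q` for every
Hermitian `H` on a nonempty sector. [cite: KomaTasaki1994, §1] -/
theorem re_gibbsState_docc_openBox_le_min (p q : ℕ)
    [Nonempty (Subtype (spinConfig (Λ := Fin a ×ₗ Fin b) p q))]
    {H : Matrix (Subtype (spinConfig (Λ := Fin a ×ₗ Fin b) p q))
      (Subtype (spinConfig (Λ := Fin a ×ₗ Fin b) p q)) ℂ} (hH : H.IsHermitian) (β : ℝ) :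
    (gibbsState β H (spinSectorHamiltonian p q (hubbardOpenBoxTT' a b 0 0 1))).re ≤ ((min p q : ℕ) : ℝ) := by
  have h0 := (Complex.nonneg_iff.mp (gibbsState_nonneg_of_posSemidef β hH
    (posSemidef_min_smul_one_sub_spinSectorHamiltonian_docc a b p q))).1
  rw [map_sub, map_smul, gibbsState_one β H (partitionFn_pos β hH).ne', smul_eq_mul, mul_one,
    Complex.sub_re, Complex.natCast_re] at h0
  linarith

/-- A positive partition function forces a nonempty sector (on an empty index type the trace vanishes).
[folklore] -/
private theorem nonempty_of_partitionFn_re_pos {m : Type*} [Fintype m] [DecidableEq m] {β : ℝ} {H : Matrix m m ℂ}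
    (h : 0 < (partitionFn β H).re) : Nonempty m := by
  by_contra hm
  haveI : IsEmpty m := not_nonempty_iff.mp hm
  have h0 : partitionFn β H = 0 := by
    simp [partitionFn, Matrix.trace]
  rw [h0, Complex.zero_re] at h
  exact lt_irrefl _ h

/-! ### §2 The `U`-direction: antitone, Peierls–Bogoliubov bracket, tangent floors -/

/-- **The open-box canonical partition function is ANTITONE in `U`** (`β ≥ 0`, logarithmic form):
`U₁ ≤ U₂ ⇒ log Re Z_β(H^open(t,s,U₂); p,q) ≤ log Re Z_β(H^open(t,s,U₁); p,q)` — the increment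
`(U₂−U₁)·D|` is positive semidefinite. [cite: Israel1979, Thm. I.3.4] [cite: KomaTasaki1994, §1] -/
theorem log_partitionFn_openBox_anti_U (p q : ℕ)
    [Nonempty (Subtype (spinConfig (Λ := Fin a ×ₗ Fin b) p q))] (t s : ℝ) {β : ℝ} (hβ : 0 ≤ β)
    {U₁ U₂ : ℝ} (hU : U₁ ≤ U₂) :
    Real.log (partitionFn β (spinSectorHamiltonian p q (hubbardOpenBoxTT' a b t s U₂))).re ≤
      Real.log (partitionFn β (spinSectorHamiltonian p q (hubbardOpenBoxTT' a b t s U₁))).re := by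
  refine log_partitionFn_le_of_posSemidef (isHermitian_spinSectorHamiltonian_hubbardOpenBoxTT' a b p q t s U₁)
    (isHermitian_spinSectorHamiltonian_hubbardOpenBoxTT' a b p q t s U₂) hβ ?_
  rw [spinSectorHamiltonian_hubbardOpenBoxTT'_eq_add_smul_U a b p q t s U₁ U₂, add_sub_cancel_left]
  exact posSemidef_real_smul_spinSectorHamiltonian_docc a b p q (sub_nonneg.2 hU)

/-- **The open-box canonical partition function is ANTITONE in `U`** (`β ≥ 0`):
`U₁ ≤ U₂ ⇒ Re Z_β(H^open(t,s,U₂); p,q) ≤ Re Z_β(H^open(t,s,U₁); p,q)` (an empty sector gives `0 ≤ 0`).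
[cite: Israel1979, Thm. I.3.4] [cite: KomaTasaki1994, §1] -/
theorem partitionFn_openBox_re_anti_U (p q : ℕ) (t s : ℝ) {β : ℝ} (hβ : 0 ≤ β) {U₁ U₂ : ℝ} (hU : U₁ ≤ U₂) :
    (partitionFn β (spinSectorHamiltonian p q (hubbardOpenBoxTT' a b t s U₂))).re ≤
      (partitionFn β (spinSectorHamiltonian p q (hubbardOpenBoxTT' a b t s U₁))).re := by
  rcases isEmpty_or_nonempty (Subtype (spinConfig (Λ := Fin a ×ₗ Fin b) p q)) with hS | hS
  · simp [partitionFn, Matrix.trace]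
  · exact (Real.log_le_log_iff
      (partitionFn_re_pos (isHermitian_spinSectorHamiltonian_hubbardOpenBoxTT' a b p q t s U₂) β)
      (partitionFn_re_pos (isHermitian_spinSectorHamiltonian_hubbardOpenBoxTT' a b p q t s U₁) β)).1
      (log_partitionFn_openBox_anti_U a b p q t s hβ hU)

/-- **A certified box floor moves DOWN in `U` for free**: `U ≤ U_A`, `β ≥ 0` and
`z ≤ Re Z_β(H^open(t,s,U_A); p,q)` give `z ≤ Re Z_β(H^open(t,s,U); p,q)` — the `T > 0` free-energy-route twin
of «a cap at the right end words the box» (`HubbardTTPrimeUBoxWords` §1). [cite: Israel1979, Thm. I.3.4] -/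
theorem openBox_partitionFn_floor_of_le_U (p q : ℕ) (t s : ℝ) {β : ℝ} (hβ : 0 ≤ β) {U U₀ : ℝ}
    (hU : U ≤ U₀) {z : ℝ}
    (hz : z ≤ (partitionFn β (spinSectorHamiltonian p q (hubbardOpenBoxTT' a b t s U₀))).re) :
    z ≤ (partitionFn β (spinSectorHamiltonian p q (hubbardOpenBoxTT' a b t s U))).re :=
  hz.trans (partitionFn_openBox_re_anti_U a b p q t s hβ hU)

/-- **Peierls–Bogoliubov bracket along `U` for the open box** (every real `β`):
`log Z(U₁) − log Z(U₂) ∈ [β(U₂−U₁)⟨D|⟩_{β,U₂}, β(U₂−U₁)⟨D|⟩_{β,U₁}]` — the free-energy increment lies between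
the interaction increments read in the two canonical Gibbs states of the box. [cite: Lieb1973, §V (5.2)–(5.4)] -/
theorem log_partitionFn_openBox_sub_mem_Icc_U (p q : ℕ)
    [Nonempty (Subtype (spinConfig (Λ := Fin a ×ₗ Fin b) p q))] (t s β U₁ U₂ : ℝ) :
    Real.log (partitionFn β (spinSectorHamiltonian p q (hubbardOpenBoxTT' a b t s U₁))).re -
        Real.log (partitionFn β (spinSectorHamiltonian p q (hubbardOpenBoxTT' a b t s U₂))).re ∈
      Set.Icc
        (β * ((U₂ - U₁) * (gibbsState β (spinSectorHamiltonian p q (hubbardOpenBoxTT' a b t s U₂))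
          (spinSectorHamiltonian p q (hubbardOpenBoxTT' a b 0 0 1))).re))
        (β * ((U₂ - U₁) * (gibbsState β (spinSectorHamiltonian p q (hubbardOpenBoxTT' a b t s U₁))
          (spinSectorHamiltonian p q (hubbardOpenBoxTT' a b 0 0 1))).re)) := by
  have hH := isHermitian_spinSectorHamiltonian_hubbardOpenBoxTT' a b p q t s U₁
  have hW : (((U₂ - U₁ : ℝ) : ℂ) • spinSectorHamiltonian p q (hubbardOpenBoxTT' a b 0 0 1)).IsHermitian :=
    isHermitian_real_smul (isHermitian_spinSectorHamiltonian_hubbardOpenBoxTT' a b p q 0 0 1) _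
  have hb := log_partitionFn_sub_mem_Icc hH hW β
  rw [← spinSectorHamiltonian_hubbardOpenBoxTT'_eq_add_smul_U a b p q t s U₁ U₂, map_smul, map_smul,
    smul_eq_mul, smul_eq_mul, Complex.re_ofReal_mul, Complex.re_ofReal_mul] at hb
  exact hb

/-- **The thermal double occupancy of the box is antitone in `U`** (`β > 0`): for `U₁ ≤ U₂`,
`⟨D|⟩_{β,H^open(t,s,U₂)} ≤ ⟨D|⟩_{β,H^open(t,s,U₁)}` (both ends of the Peierls–Bogoliubov bracket).
[cite: Lieb1973, §V (5.2)–(5.4)] [cite: KomaTasaki1994, §1] -/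
theorem re_gibbsState_docc_openBox_anti_U (p q : ℕ)
    [Nonempty (Subtype (spinConfig (Λ := Fin a ×ₗ Fin b) p q))] (t s : ℝ) {β : ℝ} (hβ : 0 < β)
    {U₁ U₂ : ℝ} (hU : U₁ ≤ U₂) :
    (gibbsState β (spinSectorHamiltonian p q (hubbardOpenBoxTT' a b t s U₂))
        (spinSectorHamiltonian p q (hubbardOpenBoxTT' a b 0 0 1))).re ≤
      (gibbsState β (spinSectorHamiltonian p q (hubbardOpenBoxTT' a b t s U₁))
        (spinSectorHamiltonian p q (hubbardOpenBoxTT' a b 0 0 1))).re := by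
  rcases hU.eq_or_lt with h | hlt
  · subst h; exact le_rfl
  have hd : 0 < U₂ - U₁ := sub_pos.2 hlt
  have hb := log_partitionFn_openBox_sub_mem_Icc_U a b p q t s β U₁ U₂
  have hle := hb.1.trans hb.2
  have hle' := le_of_mul_le_mul_left hle hβ
  exact le_of_mul_le_mul_left hle' hd

/-- **TANGENT FLOOR along `U`** (Peierls–Bogoliubov, every real `β`, EVERY target `U` on either side of the
anchor): `log Z(U_A) − β(U−U_A)⟨D|⟩_{β,U_A} ≤ log Z(U)` — the Hellmann–Feynman slope is the anchor's thermal
double occupancy. [cite: Lieb1973, §V (5.2)–(5.4)] [cite: KomaTasaki1994, §1] -/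
theorem log_partitionFn_openBox_ge_tangent_U (p q : ℕ)
    [Nonempty (Subtype (spinConfig (Λ := Fin a ×ₗ Fin b) p q))] (t s β U U₀ : ℝ) :
    Real.log (partitionFn β (spinSectorHamiltonian p q (hubbardOpenBoxTT' a b t s U₀))).re -
        β * ((U - U₀) * (gibbsState β (spinSectorHamiltonian p q (hubbardOpenBoxTT' a b t s U₀))
          (spinSectorHamiltonian p q (hubbardOpenBoxTT' a b 0 0 1))).re) ≤
      Real.log (partitionFn β (spinSectorHamiltonian p q (hubbardOpenBoxTT' a b t s U))).re := by
  have hH := isHermitian_spinSectorHamiltonian_hubbardOpenBoxTT' a b p q t s U₀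
  have hW : (((U - U₀ : ℝ) : ℂ) • spinSectorHamiltonian p q (hubbardOpenBoxTT' a b 0 0 1)).IsHermitian :=
    isHermitian_real_smul (isHermitian_spinSectorHamiltonian_hubbardOpenBoxTT' a b p q 0 0 1) _
  have h := log_partitionFn_sub_le_log_partitionFn_add hH hW β
  rw [← spinSectorHamiltonian_hubbardOpenBoxTT'_eq_add_smul_U a b p q t s U₀ U, map_smul, smul_eq_mul,
    Complex.re_ofReal_mul] at h
  exact h

/-- Sign-split reading of a slope window: `lo ≤ d ≤ hi` gives `c·d ≤ max (c·lo) (c·hi)` for every real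
`c`. [folklore] -/
private theorem mul_le_max_mul_of_mem_Icc' {d lo hi : ℝ} (hlo : lo ≤ d) (hhi : d ≤ hi) (c : ℝ) :
    c * d ≤ max (c * lo) (c * hi) := by
  rcases le_total 0 c with hc | hc
  · exact (mul_le_mul_of_nonneg_left hhi hc).trans (le_max_right _ _)
  · exact (mul_le_mul_of_nonpos_left hlo hc).trans (le_max_left _ _)

/-- **Tangent floor along `U`, priced by a certified docc window at the anchor** (`β ≥ 0`):
`dlo ≤ ⟨D|⟩_{β,U_A} ≤ dhi` gives `log Z(U_A) − β·max((U−U_A)·dlo, (U−U_A)·dhi) ≤ log Z(U)` for every `U`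
(to the right the ceiling `dhi` is used, to the left the floor `dlo`). [cite: Lieb1973, §V (5.2)–(5.4)] -/
theorem log_partitionFn_openBox_ge_of_docc_mem_Icc_U (p q : ℕ)
    [Nonempty (Subtype (spinConfig (Λ := Fin a ×ₗ Fin b) p q))] (t s : ℝ) {β : ℝ} (hβ : 0 ≤ β)
    (U U₀ : ℝ) {dlo dhi : ℝ}
    (hlo : dlo ≤ (gibbsState β (spinSectorHamiltonian p q (hubbardOpenBoxTT' a b t s U₀))
      (spinSectorHamiltonian p q (hubbardOpenBoxTT' a b 0 0 1))).re)
    (hhi : (gibbsState β (spinSectorHamiltonian p q (hubbardOpenBoxTT' a b t s U₀))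
      (spinSectorHamiltonian p q (hubbardOpenBoxTT' a b 0 0 1))).re ≤ dhi) :
    Real.log (partitionFn β (spinSectorHamiltonian p q (hubbardOpenBoxTT' a b t s U₀))).re -
        β * max ((U - U₀) * dlo) ((U - U₀) * dhi) ≤
      Real.log (partitionFn β (spinSectorHamiltonian p q (hubbardOpenBoxTT' a b t s U))).re := by
  have h := log_partitionFn_openBox_ge_tangent_U a b p q t s β U U₀
  have hm := mul_le_mul_of_nonneg_left (mul_le_max_mul_of_mem_Icc' hlo hhi (U - U₀)) hβ
  linarith

/-- **Kinematic tangent floor along `U`** (`β ≥ 0`, no anchor data beyond `Z`): with `0 ≤ ⟨D|⟩ ≤ min p q`,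
`log Z(U_A) − β·(U−U_A)⁺·min p q ≤ log Z(U)` for every `U`. [cite: Lieb1973, §V (5.2)–(5.4)]
[cite: KomaTasaki1994, §1] -/
theorem log_partitionFn_openBox_ge_kinematic_U (p q : ℕ)
    [Nonempty (Subtype (spinConfig (Λ := Fin a ×ₗ Fin b) p q))] (t s : ℝ) {β : ℝ} (hβ : 0 ≤ β)
    (U U₀ : ℝ) :
    Real.log (partitionFn β (spinSectorHamiltonian p q (hubbardOpenBoxTT' a b t s U₀))).re -
        β * (max (U - U₀) 0 * ((min p q : ℕ) : ℝ)) ≤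
      Real.log (partitionFn β (spinSectorHamiltonian p q (hubbardOpenBoxTT' a b t s U))).re := by
  have h := log_partitionFn_openBox_ge_of_docc_mem_Icc_U a b p q t s hβ U U₀
    (re_gibbsState_docc_openBox_nonneg a b p q
      (isHermitian_spinSectorHamiltonian_hubbardOpenBoxTT' a b p q t s U₀) β)
    (re_gibbsState_docc_openBox_le_min a b p q
      (isHermitian_spinSectorHamiltonian_hubbardOpenBoxTT' a b p q t s U₀) β)
  have hmax : max ((U - U₀) * 0) ((U - U₀) * ((min p q : ℕ) : ℝ)) =
      max (U - U₀) 0 * ((min p q : ℕ) : ℝ) := by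
    rw [max_mul_of_nonneg _ _ (Nat.cast_nonneg _), mul_zero, zero_mul, max_comm]
  rw [hmax] at h
  exact h

/-- **`z`-FORM OF THE `U`-TRANSPORT (what a free-energy-route producer consumes)** (`β ≥ 0`): a certified
floor `0 < z ≤ Re Z_β(H^open(t,s,U_A); p,q)` and a certified docc window `dlo ≤ ⟨D|⟩_{β,U_A} ≤ dhi` at the
anchor give, at EVERY `U`, the certified floor `z·exp(−β·max((U−U_A)dlo, (U−U_A)dhi)) ≤ Re Z_β(H^open(t,s,U); p,q)`.
[cite: Lieb1973, §V (5.2)–(5.4)] [cite: Israel1979, Thm. I.3.4] -/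
theorem openBox_partitionFn_floor_transport_U (p q : ℕ) (t s : ℝ) {β : ℝ} (hβ : 0 ≤ β) (U U₀ : ℝ)
    {z : ℝ} (hz0 : 0 < z)
    (hz : z ≤ (partitionFn β (spinSectorHamiltonian p q (hubbardOpenBoxTT' a b t s U₀))).re)
    {dlo dhi : ℝ}
    (hlo : dlo ≤ (gibbsState β (spinSectorHamiltonian p q (hubbardOpenBoxTT' a b t s U₀))
      (spinSectorHamiltonian p q (hubbardOpenBoxTT' a b 0 0 1))).re)
    (hhi : (gibbsState β (spinSectorHamiltonian p q (hubbardOpenBoxTT' a b t s U₀))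
      (spinSectorHamiltonian p q (hubbardOpenBoxTT' a b 0 0 1))).re ≤ dhi) :
    z * Real.exp (-(β * max ((U - U₀) * dlo) ((U - U₀) * dhi))) ≤
      (partitionFn β (spinSectorHamiltonian p q (hubbardOpenBoxTT' a b t s U))).re := by
  haveI := nonempty_of_partitionFn_re_pos (hz0.trans_le hz)
  have hZU := partitionFn_re_pos (isHermitian_spinSectorHamiltonian_hubbardOpenBoxTT' a b p q t s U) β
  have h := log_partitionFn_openBox_ge_of_docc_mem_Icc_U a b p q t s hβ U U₀ hlo hhi
  have hlogz := Real.log_le_log hz0 hz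
  rw [← Real.log_le_log_iff (mul_pos hz0 (Real.exp_pos _)) hZU, Real.log_mul hz0.ne' (Real.exp_pos _).ne',
    Real.log_exp]
  linarith

/-- **Kinematic `z`-form of the `U`-transport** (`β ≥ 0`): `0 < z ≤ Re Z_β(H^open(t,s,U_A); p,q)` gives
`z·exp(−β·(U−U_A)⁺·min p q) ≤ Re Z_β(H^open(t,s,U); p,q)` at every `U` (no loss to the left of the anchor,
the kinematic docc ceiling to the right). [cite: Lieb1973, §V (5.2)–(5.4)] [cite: KomaTasaki1994, §1] -/
theorem openBox_partitionFn_floor_transport_U_kinematic (p q : ℕ) (t s : ℝ) {β : ℝ} (hβ : 0 ≤ β)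
    (U U₀ : ℝ) {z : ℝ} (hz0 : 0 < z)
    (hz : z ≤ (partitionFn β (spinSectorHamiltonian p q (hubbardOpenBoxTT' a b t s U₀))).re) :
    z * Real.exp (-(β * (max (U - U₀) 0 * ((min p q : ℕ) : ℝ)))) ≤
      (partitionFn β (spinSectorHamiltonian p q (hubbardOpenBoxTT' a b t s U))).re := by
  haveI := nonempty_of_partitionFn_re_pos (hz0.trans_le hz)
  have hZU := partitionFn_re_pos (isHermitian_spinSectorHamiltonian_hubbardOpenBoxTT' a b p q t s U) β
  have h := log_partitionFn_openBox_ge_kinematic_U a b p q t s hβ U U₀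
  have hlogz := Real.log_le_log hz0 hz
  rw [← Real.log_le_log_iff (mul_pos hz0 (Real.exp_pos _)) hZU, Real.log_mul hz0.ne' (Real.exp_pos _).ne',
    Real.log_exp]
  linarith

/-! ### §3 Joint tangent planes: `(t, s, U)` at fixed `β`, and temperature × couplings -/

/-- **Peierls–Bogoliubov tangent plane in all three couplings** (every real `β`):
`log Z_β(t₀,s₀,U₀) − β[(t−t₀)⟨K₁|⟩₀ + (s−s₀)⟨K₂|⟩₀ + (U−U₀)⟨D|⟩₀] ≤ log Z_β(t,s,U)`, the slopes being the
thermal means of the three coupling directions in the ANCHOR's canonical Gibbs state of the box.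
[cite: Lieb1973, §V (5.2)–(5.4)] -/
theorem log_partitionFn_openBox_ge_tangent (p q : ℕ)
    [Nonempty (Subtype (spinConfig (Λ := Fin a ×ₗ Fin b) p q))] (β t s U t₀ s₀ U₀ : ℝ) :
    Real.log (partitionFn β (spinSectorHamiltonian p q (hubbardOpenBoxTT' a b t₀ s₀ U₀))).re -
        β * ((t - t₀) * (gibbsState β (spinSectorHamiltonian p q (hubbardOpenBoxTT' a b t₀ s₀ U₀))
              (spinSectorHamiltonian p q (hubbardOpenBoxTT' a b 1 0 0))).re +
            (s - s₀) * (gibbsState β (spinSectorHamiltonian p q (hubbardOpenBoxTT' a b t₀ s₀ U₀))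
              (spinSectorHamiltonian p q (hubbardOpenBoxTT' a b 0 1 0))).re +
            (U - U₀) * (gibbsState β (spinSectorHamiltonian p q (hubbardOpenBoxTT' a b t₀ s₀ U₀))
              (spinSectorHamiltonian p q (hubbardOpenBoxTT' a b 0 0 1))).re) ≤
      Real.log (partitionFn β (spinSectorHamiltonian p q (hubbardOpenBoxTT' a b t s U))).re := by
  have hH := isHermitian_spinSectorHamiltonian_hubbardOpenBoxTT' a b p q t₀ s₀ U₀
  have hW : (spinSectorHamiltonian p q (hubbardOpenBoxTT' a b t s U) -
      spinSectorHamiltonian p q (hubbardOpenBoxTT' a b t₀ s₀ U₀)).IsHermitian :=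
    (isHermitian_spinSectorHamiltonian_hubbardOpenBoxTT' a b p q t s U).sub hH
  have h := log_partitionFn_sub_le_log_partitionFn_add hH hW β
  rw [add_sub_cancel, spinSectorHamiltonian_hubbardOpenBoxTT'_sub a b p q t s U t₀ s₀ U₀, map_add, map_add,
    map_smul, map_smul, map_smul, smul_eq_mul, smul_eq_mul, smul_eq_mul, Complex.add_re, Complex.add_re,
    Complex.re_ofReal_mul, Complex.re_ofReal_mul, Complex.re_ofReal_mul] at h
  linarith

/-- **Tangent floor in `(t', U)` at fixed `t`, priced by certified slope windows at the anchor** (`β ≥ 0`):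
`τlo ≤ ⟨K₂|⟩₀ ≤ τhi` and `dlo ≤ ⟨D|⟩₀ ≤ dhi` give
`log Z_β(t,s₀,U₀) − β[max((s−s₀)τlo, (s−s₀)τhi) + max((U−U₀)dlo, (U−U₀)dhi)] ≤ log Z_β(t,s,U)`.
[cite: Lieb1973, §V (5.2)–(5.4)] -/
theorem log_partitionFn_openBox_ge_of_slopes_mem_Icc (p q : ℕ)
    [Nonempty (Subtype (spinConfig (Λ := Fin a ×ₗ Fin b) p q))] (t : ℝ) {β : ℝ} (hβ : 0 ≤ β)
    (s U s₀ U₀ : ℝ) {τlo τhi dlo dhi : ℝ}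
    (hτlo : τlo ≤ (gibbsState β (spinSectorHamiltonian p q (hubbardOpenBoxTT' a b t s₀ U₀))
      (spinSectorHamiltonian p q (hubbardOpenBoxTT' a b 0 1 0))).re)
    (hτhi : (gibbsState β (spinSectorHamiltonian p q (hubbardOpenBoxTT' a b t s₀ U₀))
      (spinSectorHamiltonian p q (hubbardOpenBoxTT' a b 0 1 0))).re ≤ τhi)
    (hdlo : dlo ≤ (gibbsState β (spinSectorHamiltonian p q (hubbardOpenBoxTT' a b t s₀ U₀))
      (spinSectorHamiltonian p q (hubbardOpenBoxTT' a b 0 0 1))).re)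
    (hdhi : (gibbsState β (spinSectorHamiltonian p q (hubbardOpenBoxTT' a b t s₀ U₀))
      (spinSectorHamiltonian p q (hubbardOpenBoxTT' a b 0 0 1))).re ≤ dhi) :
    Real.log (partitionFn β (spinSectorHamiltonian p q (hubbardOpenBoxTT' a b t s₀ U₀))).re -
        β * (max ((s - s₀) * τlo) ((s - s₀) * τhi) + max ((U - U₀) * dlo) ((U - U₀) * dhi)) ≤
      Real.log (partitionFn β (spinSectorHamiltonian p q (hubbardOpenBoxTT' a b t s U))).re := by
  have h := log_partitionFn_openBox_ge_tangent a b p q β t s U t s₀ U₀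
  rw [sub_self, zero_mul, zero_add] at h
  have h1 := mul_le_max_mul_of_mem_Icc' hτlo hτhi (s - s₀)
  have h2 := mul_le_max_mul_of_mem_Icc' hdlo hdhi (U - U₀)
  have hm := mul_le_mul_of_nonneg_left (add_le_add h1 h2) hβ
  linarith

/-- **`z`-FORM OF THE JOINT `(t', U)`-TRANSPORT** (`β ≥ 0`): a certified floor
`0 < z ≤ Re Z_β(H^open(t,s_A,U_A); p,q)` and certified slope windows at the anchor give, at EVERY `(s, U)`,
`z·exp(−β[max((s−s_A)τlo, (s−s_A)τhi) + max((U−U_A)dlo, (U−U_A)dhi)]) ≤ Re Z_β(H^open(t,s,U); p,q)`.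
[cite: Lieb1973, §V (5.2)–(5.4)] [cite: Israel1979, Thm. I.3.4] -/
theorem openBox_partitionFn_floor_transport (p q : ℕ) (t : ℝ) {β : ℝ} (hβ : 0 ≤ β) (s U s₀ U₀ : ℝ)
    {z : ℝ} (hz0 : 0 < z)
    (hz : z ≤ (partitionFn β (spinSectorHamiltonian p q (hubbardOpenBoxTT' a b t s₀ U₀))).re)
    {τlo τhi dlo dhi : ℝ}
    (hτlo : τlo ≤ (gibbsState β (spinSectorHamiltonian p q (hubbardOpenBoxTT' a b t s₀ U₀))
      (spinSectorHamiltonian p q (hubbardOpenBoxTT' a b 0 1 0))).re)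
    (hτhi : (gibbsState β (spinSectorHamiltonian p q (hubbardOpenBoxTT' a b t s₀ U₀))
      (spinSectorHamiltonian p q (hubbardOpenBoxTT' a b 0 1 0))).re ≤ τhi)
    (hdlo : dlo ≤ (gibbsState β (spinSectorHamiltonian p q (hubbardOpenBoxTT' a b t s₀ U₀))
      (spinSectorHamiltonian p q (hubbardOpenBoxTT' a b 0 0 1))).re)
    (hdhi : (gibbsState β (spinSectorHamiltonian p q (hubbardOpenBoxTT' a b t s₀ U₀))
      (spinSectorHamiltonian p q (hubbardOpenBoxTT' a b 0 0 1))).re ≤ dhi) :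
    z * Real.exp (-(β * (max ((s - s₀) * τlo) ((s - s₀) * τhi) + max ((U - U₀) * dlo) ((U - U₀) * dhi)))) ≤
      (partitionFn β (spinSectorHamiltonian p q (hubbardOpenBoxTT' a b t s U))).re := by
  haveI := nonempty_of_partitionFn_re_pos (hz0.trans_le hz)
  have hZU := partitionFn_re_pos (isHermitian_spinSectorHamiltonian_hubbardOpenBoxTT' a b p q t s U) β
  have h := log_partitionFn_openBox_ge_of_slopes_mem_Icc a b p q t hβ s U s₀ U₀ hτlo hτhi hdlo hdhi
  have hlogz := Real.log_le_log hz0 hz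
  rw [← Real.log_le_log_iff (mul_pos hz0 (Real.exp_pos _)) hZU, Real.log_mul hz0.ne' (Real.exp_pos _).ne',
    Real.log_exp]
  linarith

/-- The open-box sector Hamiltonian as a LINEAR family on `ℝ³ ∋ (t, s, U)`. [cite: Israel1979, Thm. I.3.4] -/
theorem spinSectorHamiltonian_hubbardOpenBoxTT'_linear (p q : ℕ) (x y : ℝ × ℝ × ℝ) (c d : ℝ) :
    spinSectorHamiltonian p q
        (hubbardOpenBoxTT' a b (c • x + d • y).1 (c • x + d • y).2.1 (c • x + d • y).2.2) =
      (c : ℂ) • spinSectorHamiltonian p q (hubbardOpenBoxTT' a b x.1 x.2.1 x.2.2) +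
        (d : ℂ) • spinSectorHamiltonian p q (hubbardOpenBoxTT' a b y.1 y.2.1 y.2.2) := by
  rw [spinSectorHamiltonian_hubbardOpenBoxTT'_eq_smul_add a b p q (c • x + d • y).1,
    spinSectorHamiltonian_hubbardOpenBoxTT'_eq_smul_add a b p q x.1 x.2.1 x.2.2,
    spinSectorHamiltonian_hubbardOpenBoxTT'_eq_smul_add a b p q y.1 y.2.1 y.2.2]
  simp only [Prod.smul_fst, Prod.smul_snd, Prod.fst_add, Prod.snd_add, smul_eq_mul, Complex.ofReal_add,
    Complex.ofReal_mul]
  module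

/-- **Convexity of `(t, s, U) ↦ log Re Z_β(H^open(t,s,U); p,q)`** on `ℝ³` (nonempty sector, every real `β`).
[cite: Israel1979, Thm. I.3.4] -/
theorem convexOn_log_partitionFn_openBox (p q : ℕ)
    [Nonempty (Subtype (spinConfig (Λ := Fin a ×ₗ Fin b) p q))] (β : ℝ) :
    ConvexOn ℝ Set.univ fun x : ℝ × ℝ × ℝ =>
      Real.log (partitionFn β (spinSectorHamiltonian p q (hubbardOpenBoxTT' a b x.1 x.2.1 x.2.2))).re :=
  convexOn_log_partitionFn_affine
    (H := fun x : ℝ × ℝ × ℝ => spinSectorHamiltonian p q (hubbardOpenBoxTT' a b x.1 x.2.1 x.2.2))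
    (fun x y c d _ => spinSectorHamiltonian_hubbardOpenBoxTT'_linear a b p q x y c d)
    (fun x => isHermitian_spinSectorHamiltonian_hubbardOpenBoxTT' a b p q x.1 x.2.1 x.2.2) β

/-- **The TEMPERATURE × COUPLING tangent plane of the open box**:
`log Z_{β₀}(t₀,s₀,U₀) − [(βt−β₀t₀)⟨K₁|⟩₀ + (βs−β₀s₀)⟨K₂|⟩₀ + (βU−β₀U₀)⟨D|⟩₀] ≤ log Z_β(t,s,U)` — ONE anchor
`(β₀; t₀,s₀,U₀)` with its three thermal means floors the box `log`-partition function at every temperature and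
coupling (at `β = β₀` it is `log_partitionFn_openBox_ge_tangent`). [cite: Israel1979, Thm. I.3.4]
[cite: Lieb1973, §V (5.2)–(5.4)] -/
theorem log_partitionFn_openBox_ge_tangent_temperature (p q : ℕ)
    [Nonempty (Subtype (spinConfig (Λ := Fin a ×ₗ Fin b) p q))] (β β₀ t s U t₀ s₀ U₀ : ℝ) :
    Real.log (partitionFn β₀ (spinSectorHamiltonian p q (hubbardOpenBoxTT' a b t₀ s₀ U₀))).re -
        ((β * t - β₀ * t₀) * (gibbsState β₀ (spinSectorHamiltonian p q (hubbardOpenBoxTT' a b t₀ s₀ U₀))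
            (spinSectorHamiltonian p q (hubbardOpenBoxTT' a b 1 0 0))).re +
          (β * s - β₀ * s₀) * (gibbsState β₀ (spinSectorHamiltonian p q (hubbardOpenBoxTT' a b t₀ s₀ U₀))
            (spinSectorHamiltonian p q (hubbardOpenBoxTT' a b 0 1 0))).re +
          (β * U - β₀ * U₀) * (gibbsState β₀ (spinSectorHamiltonian p q (hubbardOpenBoxTT' a b t₀ s₀ U₀))
            (spinSectorHamiltonian p q (hubbardOpenBoxTT' a b 0 0 1))).re) ≤
      Real.log (partitionFn β (spinSectorHamiltonian p q (hubbardOpenBoxTT' a b t s U))).re := by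
  have h := log_partitionFn_linear_ge_tangent_temperature
    (H := fun x : ℝ × ℝ × ℝ => spinSectorHamiltonian p q (hubbardOpenBoxTT' a b x.1 x.2.1 x.2.2))
    (fun x y c d => spinSectorHamiltonian_hubbardOpenBoxTT'_linear a b p q x y c d)
    (fun x => isHermitian_spinSectorHamiltonian_hubbardOpenBoxTT' a b p q x.1 x.2.1 x.2.2) β β₀ (t, s, U)
    (t₀, s₀, U₀)
  simp only at h
  have hW : (β : ℂ) • spinSectorHamiltonian p q (hubbardOpenBoxTT' a b t s U) -
      (β₀ : ℂ) • spinSectorHamiltonian p q (hubbardOpenBoxTT' a b t₀ s₀ U₀) =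
      ((β * t - β₀ * t₀ : ℝ) : ℂ) • spinSectorHamiltonian p q (hubbardOpenBoxTT' a b 1 0 0) +
        ((β * s - β₀ * s₀ : ℝ) : ℂ) • spinSectorHamiltonian p q (hubbardOpenBoxTT' a b 0 1 0) +
          ((β * U - β₀ * U₀ : ℝ) : ℂ) • spinSectorHamiltonian p q (hubbardOpenBoxTT' a b 0 0 1) := by
    rw [spinSectorHamiltonian_hubbardOpenBoxTT'_eq_smul_add a b p q t s U,
      spinSectorHamiltonian_hubbardOpenBoxTT'_eq_smul_add a b p q t₀ s₀ U₀]
    simp only [Complex.ofReal_sub, Complex.ofReal_mul]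
    module
  rw [hW, map_add, map_add, map_smul, map_smul, map_smul, smul_eq_mul, smul_eq_mul, smul_eq_mul,
    Complex.add_re, Complex.add_re, Complex.re_ofReal_mul, Complex.re_ofReal_mul, Complex.re_ofReal_mul] at h
  exact h

/-- **Coupling Lipschitz bound for the open box** (`β ≥ 0`):
`|log Z_β(t,s,U) − log Z_β(t,s₀,U₀)| ≤ β(|s−s₀|·‖K₂|‖ + |U−U₀|·‖D|‖)` (L²-operator norms of the compressed
directions). [cite: Israel1979, Thm. I.3.4] -/
theorem abs_log_partitionFn_openBox_sub_le (p q : ℕ)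
    [Nonempty (Subtype (spinConfig (Λ := Fin a ×ₗ Fin b) p q))] (t : ℝ) {β : ℝ} (hβ : 0 ≤ β)
    (s U s₀ U₀ : ℝ) :
    |Real.log (partitionFn β (spinSectorHamiltonian p q (hubbardOpenBoxTT' a b t s U))).re -
        Real.log (partitionFn β (spinSectorHamiltonian p q (hubbardOpenBoxTT' a b t s₀ U₀))).re| ≤
      β * (|s - s₀| * ‖spinSectorHamiltonian p q (hubbardOpenBoxTT' a b 0 1 0)‖ +
        |U - U₀| * ‖spinSectorHamiltonian p q (hubbardOpenBoxTT' a b 0 0 1)‖) := by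
  have h := abs_log_partitionFn_sub_log_partitionFn_le
    (isHermitian_spinSectorHamiltonian_hubbardOpenBoxTT' a b p q t s U)
    (isHermitian_spinSectorHamiltonian_hubbardOpenBoxTT' a b p q t s₀ U₀) hβ
  refine h.trans (mul_le_mul_of_nonneg_left ?_ hβ)
  rw [spinSectorHamiltonian_hubbardOpenBoxTT'_sub a b p q t s U t s₀ U₀, sub_self, Complex.ofReal_zero,
    zero_smul, zero_add]
  refine (norm_add_le _ _).trans (add_le_add ?_ ?_)
  · rw [norm_smul, Complex.norm_real, Real.norm_eq_abs]
  · rw [norm_smul, Complex.norm_real, Real.norm_eq_abs]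

/-! ### §4 The torus-side hot inputs are antitone in `U` -/

section Torus

variable {nf : ℝ}

/-- **The canonical-sector torus interaction enters linearly**: the increment of the compressed torus
Hamiltonian along `U` is `(U₂ − U₁)` times the compressed double occupancy.
[cite: KomaTasaki1994, §1] -/
theorem sectorHamiltonianTT'_sub_U (nf : ℝ) (L : ℕ) [NeZero L] (t s U₁ U₂ : ℝ) :
    sectorHamiltonianTT' t s U₂ nf L - sectorHamiltonianTT' t s U₁ nf L =
      (((U₂ - U₁ : ℝ) : ℂ) • ∑ x : FermionTorus 2 L, numberOp x 0 * numberOp x 1).submatrix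
        (Subtype.val : Subtype (szConfig nf L) → _) Subtype.val := by
  unfold sectorHamiltonianTT'
  rw [TTPrimeFree.hubbardTorusTT'_eq_add_smul t s U₁ U₂]
  ext i j
  simp only [submatrix_apply, Matrix.sub_apply, Matrix.add_apply, Matrix.smul_apply, smul_eq_mul]
  ring

/-- **The canonical-sector torus `log`-partition function is ANTITONE in `U`** (`0 ≤ n ≤ 2`, `β ≥ 0`, every
`L ≥ 1`): `U₁ ≤ U₂ ⇒ log Re Z_β(H_L(t,s,U₂)|_s) ≤ log Re Z_β(H_L(t,s,U₁)|_s)` — so a HOT free-energy bound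
`log Re Z ≤ u_h L²` certified at `U₁` holds at every `U ≥ U₁`. [cite: Israel1979, Thm. I.3.4]
[cite: KomaTasaki1994, §1] -/
theorem log_partitionFn_sectorHamiltonianTT'_anti_U (hn0 : 0 ≤ nf) (hn2 : nf ≤ 2) (L : ℕ) [NeZero L]
    (t s : ℝ) {β : ℝ} (hβ : 0 ≤ β) {U₁ U₂ : ℝ} (hU : U₁ ≤ U₂) :
    Real.log (partitionFn β (sectorHamiltonianTT' t s U₂ nf L)).re ≤
      Real.log (partitionFn β (sectorHamiltonianTT' t s U₁ nf L)).re := by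
  haveI := nonempty_szConfig hn0 hn2 L
  refine log_partitionFn_le_of_posSemidef (isHermitian_sectorHamiltonianTT' t s U₁ nf L)
    (isHermitian_sectorHamiltonianTT' t s U₂ nf L) hβ ?_
  rw [sectorHamiltonianTT'_sub_U nf L t s U₁ U₂]
  exact (posSemidef_real_smul_sum_numberOp_mul_numberOp (sub_nonneg.2 hU)).submatrix Subtype.val

/-- **The grand-canonical torus `log`-partition function is ANTITONE in `U`** (`β ≥ 0`, every `μ`, `L ≥ 1`):
`U₁ ≤ U₂ ⇒ log Re Z_β(H_L(t,s,U₂) − μN) ≤ log Re Z_β(H_L(t,s,U₁) − μN)` — a grand-canonical pressure bound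
certified at `U₁` holds at every `U ≥ U₁`. [cite: Israel1979, Thm. I.3.4] [cite: KomaTasaki1994, §1] -/
theorem log_partitionFn_hubbardTorusTT'_sub_mu_anti_U (L : ℕ) [NeZero L] (t s μ : ℝ) {β : ℝ} (hβ : 0 ≤ β)
    {U₁ U₂ : ℝ} (hU : U₁ ≤ U₂) :
    Real.log (partitionFn β (hubbardTorusTT' L t s U₂ - (μ : ℂ) • totalNumber)).re ≤
      Real.log (partitionFn β (hubbardTorusTT' L t s U₁ - (μ : ℂ) • totalNumber)).re := by
  refine log_partitionFn_le_of_posSemidef (isHermitian_hubbardTorusTT'_sub_mu L t s U₁ μ)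
    (isHermitian_hubbardTorusTT'_sub_mu L t s U₂ μ) hβ ?_
  have hdiff : hubbardTorusTT' L t s U₂ - (μ : ℂ) • totalNumber -
      (hubbardTorusTT' L t s U₁ - (μ : ℂ) • totalNumber) =
      ((U₂ - U₁ : ℝ) : ℂ) • ∑ x : FermionTorus 2 L, numberOp x 0 * numberOp x 1 := by
    rw [TTPrimeFree.hubbardTorusTT'_eq_add_smul t s U₁ U₂]
    abel
  rw [hdiff]
  exact posSemidef_real_smul_sum_numberOp_mul_numberOp (sub_nonneg.2 hU)

/-- **An eventual hot canonical free-energy bound moves UP in `U`**: if along `Ls → ∞`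
`log Re Z_{β_h}(H_{L_j}(t,s,U₁)|_s) ≤ u_h·L_j² + C` eventually, then the same holds at every `U ≥ U₁`
(`0 ≤ n ≤ 2`, `β_h ≥ 0`). [cite: Israel1979, Thm. I.3.4] -/
theorem eventually_log_partitionFn_sectorHamiltonianTT'_le_of_le_U (hn0 : 0 ≤ nf) (hn2 : nf ≤ 2)
    (t s : ℝ) {βh : ℝ} (hβh : 0 ≤ βh) {U₁ U : ℝ} (hU : U₁ ≤ U) {Ls : ℕ → ℕ} (hLs : Tendsto Ls atTop atTop)
    {uh C : ℝ}
    (huh : ∀ᶠ j in atTop, Real.log (partitionFn βh (sectorHamiltonianTT' t s U₁ nf (Ls j))).re ≤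
      uh * (Ls j : ℝ) ^ 2 + C) :
    ∀ᶠ j in atTop, Real.log (partitionFn βh (sectorHamiltonianTT' t s U nf (Ls j))).re ≤
      uh * (Ls j : ℝ) ^ 2 + C := by
  filter_upwards [huh, hLs.eventually_ge_atTop 1] with j hj hj1
  haveI : NeZero (Ls j) := ⟨by omega⟩
  exact (log_partitionFn_sectorHamiltonianTT'_anti_U hn0 hn2 (Ls j) t s hβh hU).trans hj

/-- **An eventual grand-canonical pressure bound moves UP in `U`**: if along `Ls → ∞`
`log Re Z_{β_h}(H_{L_j}(t,s,U₁) − μN) ≤ P·L_j²` eventually, then the same holds at every `U ≥ U₁` (`β_h ≥ 0`).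
[cite: Israel1979, Thm. I.3.4] -/
theorem eventually_log_partitionFn_grandCanonical_le_of_le_U (t s μ : ℝ) {βh : ℝ} (hβh : 0 ≤ βh)
    {U₁ U : ℝ} (hU : U₁ ≤ U) {Ls : ℕ → ℕ} (hLs : Tendsto Ls atTop atTop) {P : ℝ}
    (hP : ∀ᶠ j in atTop, Real.log (partitionFn βh (hubbardTorusTT' (Ls j) t s U₁ -
      (μ : ℂ) • totalNumber)).re ≤ P * (Ls j : ℝ) ^ 2) :
    ∀ᶠ j in atTop, Real.log (partitionFn βh (hubbardTorusTT' (Ls j) t s U -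
      (μ : ℂ) • totalNumber)).re ≤ P * (Ls j : ℝ) ^ 2 := by
  filter_upwards [hP, hLs.eventually_ge_atTop 1] with j hj hj1
  haveI : NeZero (Ls j) := ⟨by omega⟩
  exact (log_partitionFn_hubbardTorusTT'_sub_mu_anti_U (Ls j) t s μ hβh hU).trans hj

end Torus

end OpenBox

/-! ### §5 BOX ⇒ WORD: the producers fed with transported inputs -/

namespace InfVolFermionState

variable {ω : InfVolFermionState 2} {Ls : ℕ → ℕ} {β t s U : ℝ}

/-- **ONE box number at an anchor words every target coupling (filling `7/8`, `4 × 4` box).** For every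
torus limit `ω` of the canonical sector Gibbs states of the `t–t'` Hubbard model at `(t, s, U)`, `n = 7/8`,
`β > 0` along ANY `Ls → ∞`: a certified `0 < z ≤ Re Z_β(H^open_{4×4}(t,s_A,U_A); 7,7)` at an ANCHOR `(s_A, U_A)`
together with certified anchor slope windows `τlo ≤ ⟨K₂|⟩_A ≤ τhi`, `dlo ≤ ⟨D|⟩_A ≤ dhi` gives
`e_{Φ(t,s,U)}(ω) ≤ (1.371 − (log z − β[max((s−s_A)τlo,(s−s_A)τhi) + max((U−U_A)dlo,(U−U_A)dhi)])/16)/β`.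
[cite: Israel1979, Lemma II.3.1] [cite: Lieb1973, §V (5.2)–(5.4)] [cite: Ruelle1969, §3.3 (3.11)–(3.18)] -/
theorem IsTorusLimitOfMixture.meanEnergy_hubbardTTPrime_le_of_openBox_seven_eighths_allTori_of_anchor
    (h : ω.IsTorusLimitOfMixture (sectorGibbsCount (7 / 8))
      (fun L => sectorGibbsWeightTT' β t s U (7 / 8) L) (fun L => sectorGibbsVectorTT' t s U (7 / 8) L) Ls)
    (hLs : Tendsto Ls atTop atTop) (hβ : 0 < β) {s₀ U₀ z : ℝ} (hz0 : 0 < z)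
    (hz : z ≤ (partitionFn β (spinSectorHamiltonian 7 7 (hubbardOpenBoxTT' 4 4 t s₀ U₀))).re)
    {τlo τhi dlo dhi : ℝ}
    (hτlo : τlo ≤ (gibbsState β (spinSectorHamiltonian 7 7 (hubbardOpenBoxTT' 4 4 t s₀ U₀))
      (spinSectorHamiltonian 7 7 (hubbardOpenBoxTT' 4 4 0 1 0))).re)
    (hτhi : (gibbsState β (spinSectorHamiltonian 7 7 (hubbardOpenBoxTT' 4 4 t s₀ U₀))
      (spinSectorHamiltonian 7 7 (hubbardOpenBoxTT' 4 4 0 1 0))).re ≤ τhi)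
    (hdlo : dlo ≤ (gibbsState β (spinSectorHamiltonian 7 7 (hubbardOpenBoxTT' 4 4 t s₀ U₀))
      (spinSectorHamiltonian 7 7 (hubbardOpenBoxTT' 4 4 0 0 1))).re)
    (hdhi : (gibbsState β (spinSectorHamiltonian 7 7 (hubbardOpenBoxTT' 4 4 t s₀ U₀))
      (spinSectorHamiltonian 7 7 (hubbardOpenBoxTT' 4 4 0 0 1))).re ≤ dhi) :
    ω.meanEnergy (hubbardTTPrimeFermionInteraction t s U) 1 ≤
      (1371 / 1000 - (Real.log z -
          β * (max ((s - s₀) * τlo) ((s - s₀) * τhi) + max ((U - U₀) * dlo) ((U - U₀) * dhi))) / 16) / β := by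
  have hz' := openBox_partitionFn_floor_transport 4 4 7 7 t hβ.le s U s₀ U₀ hz0 hz hτlo hτhi hdlo hdhi
  have hz0' := mul_pos hz0 (Real.exp_pos
    (-(β * (max ((s - s₀) * τlo) ((s - s₀) * τhi) + max ((U - U₀) * dlo) ((U - U₀) * dhi)))))
  have hmain := h.meanEnergy_hubbardTTPrime_le_of_openBox_seven_eighths_allTori hLs hβ hz0' hz'
  rw [Real.log_mul hz0.ne' (Real.exp_pos _).ne', Real.log_exp] at hmain
  exact hmain.trans_eq (by ring)

/-- **`U`-ray, kinematic form** (no anchor data beyond `z`): for `n = 7/8`, `β > 0`, every torus limit at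
`(t, s, U)` and every certified `0 < z ≤ Re Z_β(H^open_{4×4}(t,s,U_A); 7,7)`,
`e_{Φ(t,s,U)}(ω) ≤ (1.371 − (log z − 7β(U−U_A)⁺)/16)/β` — the kinematic docc ceiling `min 7 7 = 7` of the box
prices the move to larger `U`, the move to smaller `U` is free. [cite: Israel1979, Lemma II.3.1]
[cite: Lieb1973, §V (5.2)–(5.4)] -/
theorem IsTorusLimitOfMixture.meanEnergy_hubbardTTPrime_le_of_openBox_seven_eighths_allTori_of_anchor_U_kinematic
    (h : ω.IsTorusLimitOfMixture (sectorGibbsCount (7 / 8))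
      (fun L => sectorGibbsWeightTT' β t s U (7 / 8) L) (fun L => sectorGibbsVectorTT' t s U (7 / 8) L) Ls)
    (hLs : Tendsto Ls atTop atTop) (hβ : 0 < β) {U₀ z : ℝ} (hz0 : 0 < z)
    (hz : z ≤ (partitionFn β (spinSectorHamiltonian 7 7 (hubbardOpenBoxTT' 4 4 t s U₀))).re) :
    ω.meanEnergy (hubbardTTPrimeFermionInteraction t s U) 1 ≤
      (1371 / 1000 - (Real.log z - β * (max (U - U₀) 0 * 7)) / 16) / β := by
  have hz' := openBox_partitionFn_floor_transport_U_kinematic 4 4 7 7 t s hβ.le U U₀ hz0 hz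
  have h77 : ((min 7 7 : ℕ) : ℝ) = 7 := by rw [min_self]; norm_num
  rw [h77] at hz'
  have hz0' := mul_pos hz0 (Real.exp_pos (-(β * (max (U - U₀) 0 * 7))))
  have hmain := h.meanEnergy_hubbardTTPrime_le_of_openBox_seven_eighths_allTori hLs hβ hz0' hz'
  rw [Real.log_mul hz0.ne' (Real.exp_pos _).ne', Real.log_exp] at hmain
  exact hmain.trans_eq (by ring)

/-- **`U`-ray, free direction**: for `n = 7/8`, `β > 0`, `U ≤ U_A`: a certified
`0 < z ≤ Re Z_β(H^open_{4×4}(t,s,U_A); 7,7)` at the anchor gives `e_{Φ(t,s,U)}(ω) ≤ (1.371 − log z/16)/β`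
verbatim for every torus limit at `(t, s, U)`. [cite: Israel1979, Lemma II.3.1] [cite: Israel1979, Thm. I.3.4] -/
theorem IsTorusLimitOfMixture.meanEnergy_hubbardTTPrime_le_of_openBox_seven_eighths_allTori_of_le_U
    (h : ω.IsTorusLimitOfMixture (sectorGibbsCount (7 / 8))
      (fun L => sectorGibbsWeightTT' β t s U (7 / 8) L) (fun L => sectorGibbsVectorTT' t s U (7 / 8) L) Ls)
    (hLs : Tendsto Ls atTop atTop) (hβ : 0 < β) {U₀ z : ℝ} (hU : U ≤ U₀) (hz0 : 0 < z)
    (hz : z ≤ (partitionFn β (spinSectorHamiltonian 7 7 (hubbardOpenBoxTT' 4 4 t s U₀))).re) :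
    ω.meanEnergy (hubbardTTPrimeFermionInteraction t s U) 1 ≤ (1371 / 1000 - Real.log z / 16) / β :=
  h.meanEnergy_hubbardTTPrime_le_of_openBox_seven_eighths_allTori hLs hβ hz0
    (openBox_partitionFn_floor_of_le_U 4 4 7 7 t s hβ.le hU hz)

/-- **Commensurate filling, general box, from an anchor** (`p + 1 ≤ a²`, `n = 2p/a²`, `β > 0`, every torus
limit at `(t, s, U)` along any `Ls → ∞`): a certified `0 < z ≤ Re Z_β(H^open_{a×a}(t,s_A,U_A); p,p)` with
anchor slope windows and any `s' > 2H_b(n/2)` give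
`e_{Φ(t,s,U)}(ω) ≤ (s' − (log z − β[max((s−s_A)τlo,(s−s_A)τhi) + max((U−U_A)dlo,(U−U_A)dhi)])/a²)/β`.
[cite: Ruelle1969, §3.3 (3.11)–(3.18)] [cite: Israel1979, Lemma II.3.1] [cite: Lieb1973, §V (5.2)–(5.4)] -/
theorem IsTorusLimitOfMixture.meanEnergy_hubbardTTPrime_le_entropy_sub_log_openBox_div_allTori_of_anchor
    {a p : ℕ} (ha : 1 ≤ a) (hp : p + 1 ≤ a * a) {n : ℝ} (hn : n = 2 * (p : ℝ) / (a : ℝ) ^ 2)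
    (h : ω.IsTorusLimitOfMixture (sectorGibbsCount n) (fun L => sectorGibbsWeightTT' β t s U n L)
      (fun L => sectorGibbsVectorTT' t s U n L) Ls)
    (hLs : Tendsto Ls atTop atTop) (hβ : 0 < β) {s₀ U₀ z : ℝ} (hz0 : 0 < z)
    (hz : z ≤ (partitionFn β (spinSectorHamiltonian p p (hubbardOpenBoxTT' a a t s₀ U₀))).re)
    {τlo τhi dlo dhi : ℝ}
    (hτlo : τlo ≤ (gibbsState β (spinSectorHamiltonian p p (hubbardOpenBoxTT' a a t s₀ U₀))
      (spinSectorHamiltonian p p (hubbardOpenBoxTT' a a 0 1 0))).re)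
    (hτhi : (gibbsState β (spinSectorHamiltonian p p (hubbardOpenBoxTT' a a t s₀ U₀))
      (spinSectorHamiltonian p p (hubbardOpenBoxTT' a a 0 1 0))).re ≤ τhi)
    (hdlo : dlo ≤ (gibbsState β (spinSectorHamiltonian p p (hubbardOpenBoxTT' a a t s₀ U₀))
      (spinSectorHamiltonian p p (hubbardOpenBoxTT' a a 0 0 1))).re)
    (hdhi : (gibbsState β (spinSectorHamiltonian p p (hubbardOpenBoxTT' a a t s₀ U₀))
      (spinSectorHamiltonian p p (hubbardOpenBoxTT' a a 0 0 1))).re ≤ dhi)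
    {s' : ℝ} (hs' : 2 * Real.binEntropy (n / 2) < s') :
    ω.meanEnergy (hubbardTTPrimeFermionInteraction t s U) 1 ≤
      (s' - (Real.log z -
          β * (max ((s - s₀) * τlo) ((s - s₀) * τhi) + max ((U - U₀) * dlo) ((U - U₀) * dhi))) /
            (a : ℝ) ^ 2) / β := by
  have hz' := openBox_partitionFn_floor_transport a a p p t hβ.le s U s₀ U₀ hz0 hz hτlo hτhi hdlo hdhi
  have hz0' := mul_pos hz0 (Real.exp_pos
    (-(β * (max ((s - s₀) * τlo) ((s - s₀) * τhi) + max ((U - U₀) * dlo) ((U - U₀) * dhi)))))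
  have hmain := h.meanEnergy_hubbardTTPrime_le_entropy_sub_log_openBox_div_allTori ha hp hn hLs hβ hz0' hz' hs'
  rw [Real.log_mul hz0.ne' (Real.exp_pos _).ne', Real.log_exp] at hmain
  exact hmain.trans_eq (by ring)

/-- **PRODUCER II ON A `U`-BOX WITH NO LOSS** (filling interval `[2p/a², 2(p+1)/a²)`, `0 < β_h < β`): the two
box partition-function floors certified at the RIGHT end `U₂` (`zp`, `zq`) and the hot canonical free-energy
bound certified at the LEFT end `U₁` word EVERY `U ∈ [U₁, U₂]`:
`e_{Φ(t,s,U)}(ω) ≤ (u_h − chord(n))/(β − β_h)` for every torus limit at `(t, s, U)` — the box floors move down in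
`U`, the hot bound moves up in `U`, both for free. [cite: Ruelle1969, §2.5–2.6, §3.3 (3.11)–(3.18)]
[cite: Israel1979, Thm. I.3.4] -/
theorem IsTorusLimitOfMixture.meanEnergy_hubbardTTPrime_le_hot_sub_chord_div_of_UBox_allTori
    {a p : ℕ} (ha : 1 ≤ a) (hp : p + 1 ≤ a * a) {n : ℝ}
    (hlo : 2 * (p : ℝ) / (a : ℝ) ^ 2 ≤ n) (hhi : n < 2 * ((p : ℝ) + 1) / (a : ℝ) ^ 2)
    {U₁ U₂ : ℝ} (hU₁ : U₁ ≤ U) (hU₂ : U ≤ U₂)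
    (h : ω.IsTorusLimitOfMixture (sectorGibbsCount n) (fun L => sectorGibbsWeightTT' β t s U n L)
      (fun L => sectorGibbsVectorTT' t s U n L) Ls)
    (hLs : Tendsto Ls atTop atTop) {βh : ℝ} (hβh : 0 < βh) (hlt : βh < β)
    {zp zq : ℝ} (hzp0 : 0 < zp)
    (hzp : zp ≤ (partitionFn β (spinSectorHamiltonian p p (hubbardOpenBoxTT' a a t s U₂))).re)
    (hzq0 : 0 < zq)
    (hzq : zq ≤ (partitionFn β (spinSectorHamiltonian (p + 1) (p + 1) (hubbardOpenBoxTT' a a t s U₂))).re)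
    {uh C : ℝ}
    (huh : ∀ᶠ j in atTop, Real.log (partitionFn βh (sectorHamiltonianTT' t s U₁ n (Ls j))).re ≤
      uh * (Ls j : ℝ) ^ 2 + C) :
    ω.meanEnergy (hubbardTTPrimeFermionInteraction t s U) 1 ≤
      (uh - (Real.log zp + (n * (a : ℝ) ^ 2 / 2 - p) * (Real.log zq - Real.log zp)) / (a : ℝ) ^ 2) /
        (β - βh) := by
  have hβ : 0 ≤ β := hβh.le.trans hlt.le
  obtain ⟨hn0, hn2⟩ := filling_bounds_of_box_interval ha hp hlo hhi.le
  exact h.meanEnergy_hubbardTTPrime_le_hot_sub_chord_div_of_fillingBox_allTori ha hp hlo hhi hLs hβh hlt hzp0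
    (openBox_partitionFn_floor_of_le_U a a p p t s hβ hU₂ hzp) hzq0
    (openBox_partitionFn_floor_of_le_U a a (p + 1) (p + 1) t s hβ hU₂ hzq)
    (eventually_log_partitionFn_sectorHamiltonianTT'_le_of_le_U hn0 hn2 t s hβh.le hU₁ hLs huh)

end InfVolFermionState

end Literature.MathematicalPhysics.QuantumLattice

/-! ### §6 (appended) The TEMPERATURE axis of the free-energy route: ONE anchor temperature floors the box
partition function at every `β`; temperature × coupling `z`-forms; producer I at every `β` from one box number -/

namespace Literature.MathematicalPhysics.QuantumLattice

open Matrix Finset HubbardWave0 ThermodynamicLimit LiebThm1 Literature.Probability.LatticeModels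
open _root_.Filter
open scoped _root_.Topology ComplexOrder BigOperators Matrix.Norms.L2Operator

section TemperatureAxis

variable (a b : ℕ)

/-- **The thermal energy of the box is the coupling combination of the three direction means**:
`Re⟨H^open(t,s,U)|⟩ = t·Re⟨K₁|⟩ + s·Re⟨K₂|⟩ + U·Re⟨D|⟩` in any state `⟨·⟩ = ⟨·⟩_{β,H}` on the sector.
[cite: KomaTasaki1994, §1] -/
theorem re_gibbsState_openBox_energy_eq (p q : ℕ) (t s U : ℝ)
    (H : Matrix (Subtype (spinConfig (Λ := Fin a ×ₗ Fin b) p q))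
      (Subtype (spinConfig (Λ := Fin a ×ₗ Fin b) p q)) ℂ) (β : ℝ) :
    (gibbsState β H (spinSectorHamiltonian p q (hubbardOpenBoxTT' a b t s U))).re =
      t * (gibbsState β H (spinSectorHamiltonian p q (hubbardOpenBoxTT' a b 1 0 0))).re +
        s * (gibbsState β H (spinSectorHamiltonian p q (hubbardOpenBoxTT' a b 0 1 0))).re +
          U * (gibbsState β H (spinSectorHamiltonian p q (hubbardOpenBoxTT' a b 0 0 1))).re := by
  rw [spinSectorHamiltonian_hubbardOpenBoxTT'_eq_smul_add a b p q t s U, map_add, map_add, map_smul, map_smul,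
    map_smul, smul_eq_mul, smul_eq_mul, smul_eq_mul, Complex.add_re, Complex.add_re, Complex.re_ofReal_mul,
    Complex.re_ofReal_mul, Complex.re_ofReal_mul]

/-- **The supporting line in the inverse temperature** (every real `β`, anchor `β₀`):
`log Z_{β₀}(t,s,U) − (β − β₀)·E_A ≤ log Z_β(t,s,U)`, `E_A = Re⟨H^open(t,s,U)|⟩_{β₀}` the anchor's thermal ENERGY
of the box (convexity of `β ↦ log Z_β`; the equal-coupling face of `log_partitionFn_openBox_ge_tangent_temperature`).
[cite: Israel1979, Thm. I.3.4] [cite: Lieb1973, §V (5.2)–(5.4)] -/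
theorem log_partitionFn_openBox_ge_tangent_beta (p q : ℕ)
    [Nonempty (Subtype (spinConfig (Λ := Fin a ×ₗ Fin b) p q))] (β β₀ t s U : ℝ) :
    Real.log (partitionFn β₀ (spinSectorHamiltonian p q (hubbardOpenBoxTT' a b t s U))).re -
        (β - β₀) * (gibbsState β₀ (spinSectorHamiltonian p q (hubbardOpenBoxTT' a b t s U))
          (spinSectorHamiltonian p q (hubbardOpenBoxTT' a b t s U))).re ≤
      Real.log (partitionFn β (spinSectorHamiltonian p q (hubbardOpenBoxTT' a b t s U))).re := by
  have h := log_partitionFn_openBox_ge_tangent_temperature a b p q β β₀ t s U t s U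
  rw [re_gibbsState_openBox_energy_eq]
  have e : (β * t - β₀ * t) *
        (gibbsState β₀ (spinSectorHamiltonian p q (hubbardOpenBoxTT' a b t s U))
          (spinSectorHamiltonian p q (hubbardOpenBoxTT' a b 1 0 0))).re +
      (β * s - β₀ * s) *
        (gibbsState β₀ (spinSectorHamiltonian p q (hubbardOpenBoxTT' a b t s U))
          (spinSectorHamiltonian p q (hubbardOpenBoxTT' a b 0 1 0))).re +
      (β * U - β₀ * U) *
        (gibbsState β₀ (spinSectorHamiltonian p q (hubbardOpenBoxTT' a b t s U))
          (spinSectorHamiltonian p q (hubbardOpenBoxTT' a b 0 0 1))).re =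
      (β - β₀) *
        (t * (gibbsState β₀ (spinSectorHamiltonian p q (hubbardOpenBoxTT' a b t s U))
            (spinSectorHamiltonian p q (hubbardOpenBoxTT' a b 1 0 0))).re +
          s * (gibbsState β₀ (spinSectorHamiltonian p q (hubbardOpenBoxTT' a b t s U))
            (spinSectorHamiltonian p q (hubbardOpenBoxTT' a b 0 1 0))).re +
          U * (gibbsState β₀ (spinSectorHamiltonian p q (hubbardOpenBoxTT' a b t s U))
            (spinSectorHamiltonian p q (hubbardOpenBoxTT' a b 0 0 1))).re) := by
    ring
  linarith

/-- **`z`-FORM OF THE TEMPERATURE TRANSPORT** (what producer I consumes on the `T` axis): a certified box floor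
`0 < z ≤ Re Z_{β₀}(H^open(t,s,U); p,q)` at the anchor temperature and a certified window `Elo ≤ E_A ≤ Ehi` for the
anchor's thermal energy of the box give, at EVERY real `β`, `z·exp(−max((β−β₀)Elo, (β−β₀)Ehi)) ≤ Re Z_β(H^open(t,s,U); p,q)`.
[cite: Israel1979, Thm. I.3.4] [cite: Lieb1973, §V (5.2)–(5.4)] -/
theorem openBox_partitionFn_floor_transport_beta (p q : ℕ) (t s U β β₀ : ℝ) {z : ℝ} (hz0 : 0 < z)
    (hz : z ≤ (partitionFn β₀ (spinSectorHamiltonian p q (hubbardOpenBoxTT' a b t s U))).re) {Elo Ehi : ℝ}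
    (hlo : Elo ≤ (gibbsState β₀ (spinSectorHamiltonian p q (hubbardOpenBoxTT' a b t s U))
      (spinSectorHamiltonian p q (hubbardOpenBoxTT' a b t s U))).re)
    (hhi : (gibbsState β₀ (spinSectorHamiltonian p q (hubbardOpenBoxTT' a b t s U))
      (spinSectorHamiltonian p q (hubbardOpenBoxTT' a b t s U))).re ≤ Ehi) :
    z * Real.exp (-(max ((β - β₀) * Elo) ((β - β₀) * Ehi))) ≤
      (partitionFn β (spinSectorHamiltonian p q (hubbardOpenBoxTT' a b t s U))).re := by
  haveI := nonempty_of_partitionFn_re_pos (hz0.trans_le hz)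
  have hZ := partitionFn_re_pos (isHermitian_spinSectorHamiltonian_hubbardOpenBoxTT' a b p q t s U) β
  have h := log_partitionFn_openBox_ge_tangent_beta a b p q β β₀ t s U
  have hm := mul_le_max_mul_of_mem_Icc' hlo hhi (β - β₀)
  have hlogz := Real.log_le_log hz0 hz
  rw [← Real.log_le_log_iff (mul_pos hz0 (Real.exp_pos _)) hZ, Real.log_mul hz0.ne' (Real.exp_pos _).ne',
    Real.log_exp]
  linarith

/-- **`z`-FORM OF THE JOINT TEMPERATURE × COUPLING TRANSPORT**: a certified box floor
`0 < z ≤ Re Z_{β₀}(H^open(t₀,s₀,U₀); p,q)` and certified windows for the anchor's three direction means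
(`κlo ≤ ⟨K₁|⟩₀ ≤ κhi`, `τlo ≤ ⟨K₂|⟩₀ ≤ τhi`, `dlo ≤ ⟨D|⟩₀ ≤ dhi`) give, at EVERY `(β; t, s, U)`,
`z·exp(−[max(Δ₁κlo,Δ₁κhi) + max(Δ₂τlo,Δ₂τhi) + max(Δ₃dlo,Δ₃dhi)]) ≤ Re Z_β(H^open(t,s,U); p,q)` with the scaled
increments `Δ₁ = βt − β₀t₀`, `Δ₂ = βs − β₀s₀`, `Δ₃ = βU − β₀U₀`. [cite: Israel1979, Thm. I.3.4]
[cite: Lieb1973, §V (5.2)–(5.4)] -/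
theorem openBox_partitionFn_floor_transport_temperature (p q : ℕ) (β β₀ t s U t₀ s₀ U₀ : ℝ) {z : ℝ}
    (hz0 : 0 < z) (hz : z ≤ (partitionFn β₀ (spinSectorHamiltonian p q (hubbardOpenBoxTT' a b t₀ s₀ U₀))).re)
    {κlo κhi τlo τhi dlo dhi : ℝ}
    (hκlo : κlo ≤ (gibbsState β₀ (spinSectorHamiltonian p q (hubbardOpenBoxTT' a b t₀ s₀ U₀))
      (spinSectorHamiltonian p q (hubbardOpenBoxTT' a b 1 0 0))).re)
    (hκhi : (gibbsState β₀ (spinSectorHamiltonian p q (hubbardOpenBoxTT' a b t₀ s₀ U₀))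
      (spinSectorHamiltonian p q (hubbardOpenBoxTT' a b 1 0 0))).re ≤ κhi)
    (hτlo : τlo ≤ (gibbsState β₀ (spinSectorHamiltonian p q (hubbardOpenBoxTT' a b t₀ s₀ U₀))
      (spinSectorHamiltonian p q (hubbardOpenBoxTT' a b 0 1 0))).re)
    (hτhi : (gibbsState β₀ (spinSectorHamiltonian p q (hubbardOpenBoxTT' a b t₀ s₀ U₀))
      (spinSectorHamiltonian p q (hubbardOpenBoxTT' a b 0 1 0))).re ≤ τhi)
    (hdlo : dlo ≤ (gibbsState β₀ (spinSectorHamiltonian p q (hubbardOpenBoxTT' a b t₀ s₀ U₀))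
      (spinSectorHamiltonian p q (hubbardOpenBoxTT' a b 0 0 1))).re)
    (hdhi : (gibbsState β₀ (spinSectorHamiltonian p q (hubbardOpenBoxTT' a b t₀ s₀ U₀))
      (spinSectorHamiltonian p q (hubbardOpenBoxTT' a b 0 0 1))).re ≤ dhi) :
    z * Real.exp (-(max ((β * t - β₀ * t₀) * κlo) ((β * t - β₀ * t₀) * κhi) +
          max ((β * s - β₀ * s₀) * τlo) ((β * s - β₀ * s₀) * τhi) +
          max ((β * U - β₀ * U₀) * dlo) ((β * U - β₀ * U₀) * dhi))) ≤
      (partitionFn β (spinSectorHamiltonian p q (hubbardOpenBoxTT' a b t s U))).re := by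
  haveI := nonempty_of_partitionFn_re_pos (hz0.trans_le hz)
  have hZ := partitionFn_re_pos (isHermitian_spinSectorHamiltonian_hubbardOpenBoxTT' a b p q t s U) β
  have h := log_partitionFn_openBox_ge_tangent_temperature a b p q β β₀ t s U t₀ s₀ U₀
  have h1 := mul_le_max_mul_of_mem_Icc' hκlo hκhi (β * t - β₀ * t₀)
  have h2 := mul_le_max_mul_of_mem_Icc' hτlo hτhi (β * s - β₀ * s₀)
  have h3 := mul_le_max_mul_of_mem_Icc' hdlo hdhi (β * U - β₀ * U₀)
  have hlogz := Real.log_le_log hz0 hz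
  rw [← Real.log_le_log_iff (mul_pos hz0 (Real.exp_pos _)) hZ, Real.log_mul hz0.ne' (Real.exp_pos _).ne',
    Real.log_exp]
  linarith

end TemperatureAxis

namespace InfVolFermionState

variable {ω : InfVolFermionState 2} {Ls : ℕ → ℕ} {β t s U : ℝ}

/-- **PRODUCER I AT EVERY TEMPERATURE FROM ONE BOX NUMBER** (filling `7/8`, `4 × 4` box; the `T` axis of the
phase map): for every torus limit `ω` of the canonical sector Gibbs states at `(t, s, U)` and inverse temperature
`β > 0` along ANY `Ls → ∞`, a certified `0 < z ≤ Re Z_{β₀}(H^open_{4×4}(t,s,U); 7,7)` at an ANCHOR temperature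
`β₀` with a certified window `Elo ≤ E_A ≤ Ehi` for the anchor's thermal box energy gives
`e_{Φ(t,s,U)}(ω) ≤ (1.371 − (log z − max((β−β₀)Elo, (β−β₀)Ehi))/16)/β`.
[cite: Israel1979, Lemma II.3.1] [cite: Israel1979, Thm. I.3.4] [cite: Lieb1973, §V (5.2)–(5.4)] -/
theorem IsTorusLimitOfMixture.meanEnergy_hubbardTTPrime_le_of_openBox_seven_eighths_allTori_of_anchor_beta
    (h : ω.IsTorusLimitOfMixture (sectorGibbsCount (7 / 8))
      (fun L => sectorGibbsWeightTT' β t s U (7 / 8) L) (fun L => sectorGibbsVectorTT' t s U (7 / 8) L) Ls)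
    (hLs : Tendsto Ls atTop atTop) (hβ : 0 < β) {β₀ z : ℝ} (hz0 : 0 < z)
    (hz : z ≤ (partitionFn β₀ (spinSectorHamiltonian 7 7 (hubbardOpenBoxTT' 4 4 t s U))).re) {Elo Ehi : ℝ}
    (hlo : Elo ≤ (gibbsState β₀ (spinSectorHamiltonian 7 7 (hubbardOpenBoxTT' 4 4 t s U))
      (spinSectorHamiltonian 7 7 (hubbardOpenBoxTT' 4 4 t s U))).re)
    (hhi : (gibbsState β₀ (spinSectorHamiltonian 7 7 (hubbardOpenBoxTT' 4 4 t s U))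
      (spinSectorHamiltonian 7 7 (hubbardOpenBoxTT' 4 4 t s U))).re ≤ Ehi) :
    ω.meanEnergy (hubbardTTPrimeFermionInteraction t s U) 1 ≤
      (1371 / 1000 - (Real.log z - max ((β - β₀) * Elo) ((β - β₀) * Ehi)) / 16) / β := by
  have hz' := openBox_partitionFn_floor_transport_beta 4 4 7 7 t s U β β₀ hz0 hz hlo hhi
  have hz0' := mul_pos hz0 (Real.exp_pos (-(max ((β - β₀) * Elo) ((β - β₀) * Ehi))))
  have hmain := h.meanEnergy_hubbardTTPrime_le_of_openBox_seven_eighths_allTori hLs hβ hz0' hz'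
  rw [Real.log_mul hz0.ne' (Real.exp_pos _).ne', Real.log_exp] at hmain
  exact hmain.trans_eq (by ring)

/-- **PRODUCER I ON A WHOLE (β; t′, U)-CELL FROM ONE BOX NUMBER** (filling `7/8`, `4 × 4` box): a certified
`0 < z ≤ Re Z_{β₀}(H^open_{4×4}(t,s₀,U₀); 7,7)` at an anchor `(β₀; s₀, U₀)` with certified windows for the anchor's
three direction means gives, for every torus limit at `(t, s, U)` and every `β > 0`,
`e_{Φ(t,s,U)}(ω) ≤ (1.371 − (log z − [max(Δ₁κlo,Δ₁κhi) + max(Δ₂τlo,Δ₂τhi) + max(Δ₃dlo,Δ₃dhi)])/16)/β`,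
`Δ₁ = (β−β₀)t`, `Δ₂ = βs − β₀s₀`, `Δ₃ = βU − β₀U₀`. [cite: Israel1979, Lemma II.3.1] [cite: Israel1979, Thm. I.3.4]
[cite: Lieb1973, §V (5.2)–(5.4)] -/
theorem IsTorusLimitOfMixture.meanEnergy_hubbardTTPrime_le_of_openBox_seven_eighths_allTori_of_anchor_temperature
    (h : ω.IsTorusLimitOfMixture (sectorGibbsCount (7 / 8))
      (fun L => sectorGibbsWeightTT' β t s U (7 / 8) L) (fun L => sectorGibbsVectorTT' t s U (7 / 8) L) Ls)
    (hLs : Tendsto Ls atTop atTop) (hβ : 0 < β) {β₀ s₀ U₀ z : ℝ} (hz0 : 0 < z)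
    (hz : z ≤ (partitionFn β₀ (spinSectorHamiltonian 7 7 (hubbardOpenBoxTT' 4 4 t s₀ U₀))).re)
    {κlo κhi τlo τhi dlo dhi : ℝ}
    (hκlo : κlo ≤ (gibbsState β₀ (spinSectorHamiltonian 7 7 (hubbardOpenBoxTT' 4 4 t s₀ U₀))
      (spinSectorHamiltonian 7 7 (hubbardOpenBoxTT' 4 4 1 0 0))).re)
    (hκhi : (gibbsState β₀ (spinSectorHamiltonian 7 7 (hubbardOpenBoxTT' 4 4 t s₀ U₀))
      (spinSectorHamiltonian 7 7 (hubbardOpenBoxTT' 4 4 1 0 0))).re ≤ κhi)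
    (hτlo : τlo ≤ (gibbsState β₀ (spinSectorHamiltonian 7 7 (hubbardOpenBoxTT' 4 4 t s₀ U₀))
      (spinSectorHamiltonian 7 7 (hubbardOpenBoxTT' 4 4 0 1 0))).re)
    (hτhi : (gibbsState β₀ (spinSectorHamiltonian 7 7 (hubbardOpenBoxTT' 4 4 t s₀ U₀))
      (spinSectorHamiltonian 7 7 (hubbardOpenBoxTT' 4 4 0 1 0))).re ≤ τhi)
    (hdlo : dlo ≤ (gibbsState β₀ (spinSectorHamiltonian 7 7 (hubbardOpenBoxTT' 4 4 t s₀ U₀))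
      (spinSectorHamiltonian 7 7 (hubbardOpenBoxTT' 4 4 0 0 1))).re)
    (hdhi : (gibbsState β₀ (spinSectorHamiltonian 7 7 (hubbardOpenBoxTT' 4 4 t s₀ U₀))
      (spinSectorHamiltonian 7 7 (hubbardOpenBoxTT' 4 4 0 0 1))).re ≤ dhi) :
    ω.meanEnergy (hubbardTTPrimeFermionInteraction t s U) 1 ≤
      (1371 / 1000 - (Real.log z -
          (max ((β * t - β₀ * t) * κlo) ((β * t - β₀ * t) * κhi) +
            max ((β * s - β₀ * s₀) * τlo) ((β * s - β₀ * s₀) * τhi) +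
            max ((β * U - β₀ * U₀) * dlo) ((β * U - β₀ * U₀) * dhi))) / 16) / β := by
  have hz' := openBox_partitionFn_floor_transport_temperature 4 4 7 7 β β₀ t s U t s₀ U₀ hz0 hz hκlo hκhi hτlo
    hτhi hdlo hdhi
  have hz0' := mul_pos hz0 (Real.exp_pos
    (-(max ((β * t - β₀ * t) * κlo) ((β * t - β₀ * t) * κhi) +
        max ((β * s - β₀ * s₀) * τlo) ((β * s - β₀ * s₀) * τhi) +
        max ((β * U - β₀ * U₀) * dlo) ((β * U - β₀ * U₀) * dhi))))
  have hmain := h.meanEnergy_hubbardTTPrime_le_of_openBox_seven_eighths_allTori hLs hβ hz0' hz'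
  rw [Real.log_mul hz0.ne' (Real.exp_pos _).ne', Real.log_exp] at hmain
  exact hmain.trans_eq (by ring)

end InfVolFermionState

end Literature.MathematicalPhysics.QuantumLattice
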